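import Literature.NumberTheory.Sieve.BombieriFriedlanderIwaniecDispersionSqfree
import Literature.NumberTheory.Sieve.BombieriFriedlanderIwaniecDispersionS3
import Literature.NumberTheory.Sieve.BombieriFriedlanderIwaniecDispersionMainTerm
import Literature.NumberTheory.Sieve.BombieriFriedlanderIwaniecDispersionProofs
import Literature.NumberTheory.Sieve.BombieriFriedlanderIwaniecSiegelWalfisz
import Literature.NumberTheory.Sieve.BombieriFriedlanderIwaniecTheorem5Assembly
import Literature.NumberTheory.Sieve.DivisorPowerSums
import Literature.NumberTheory.Sieve.DivisorBound
import HarnessLib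

/-!
# Bombieri–Friedlander–Iwaniec 1986, Theorem 2: the dispersion skeleton and the error terms (pre-asymptotic form)

Topic `Literature/NumberTheory/Sieve`.  Part of the assembly of **Theorem 2** of E. Bombieri,
J. B. Friedlander, H. Iwaniec, *Primes in arithmetic progressions to large moduli*, Acta Math. 156
(1986), 203–251 (the named fact `Literature.NumberTheory.Sieve.BombieriFriedlanderIwaniecTheorem2`
of `…Dispersion`), from the §3–§9 files of the tree.  This file PROVES:

* the **skeleton** `BFI.dispG_le_errors`: by the smoothing (3.4) (`dispG ≤ 𝒮₁ − 2𝒮₂ + 𝒮₃`), the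
  split `𝒮₁ = 𝒮₁ᶜ + 𝒮₁ⁿ`, and the exact cancellation of the main terms `α̂₀X`,
  `𝒢 ≤ |𝒮₁ⁿ| + |𝒮₁ᶜ(β)−𝒮₁ᶜ(β')| + ‖𝒮₁ᶜ(β')−α̂₀𝒳(β')−ℛ₁(β')‖ + ‖ℛ₁(β')‖ + ‖α̂₀‖|𝒳(β)−𝒳(β')|
   + ‖α̂₀‖|𝒳(β)−X| + 2‖𝒮₂−α̂₀X‖ + ‖𝒮₃−α̂₀X‖` for any auxiliary `β'` (downstream `β' = μ²β`);
* **pre-asymptotic bounds** for six of the eight terms, with every divisor sum discharged by the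
  moments `∑_{n≤X} τ(n)^r ≤ C_r X (log X)^{k_r}` (`BFI.MomentHyp`, from `DivisorPowerSums`) and the
  deep/structural inputs kept as explicit hypotheses: `BFI.e8_le` (`𝒮₃`, §4), `BFI.e5_le`
  (`α̂₀(𝒳(β)−𝒳(β♭))`, `…DispersionSqfree`), `BFI.e2_le` (`𝒮₁ᶜ(β)−𝒮₁ᶜ(β♭)`, `…DispersionSqfree` with
  Lemma 3 as hypothesis `hL3`), `BFI.e6_le` (`α̂₀(𝒳−X)`, §7, with the Barban–Davenport–Halberstam input
  `W` of Theorem 0 (a) as hypothesis `hBDH`), `BFI.e3_le` (Poisson tails and phase errors of `𝒮₁ᶜ`,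
  §6 (6.9)–(6.12)), `BFI.e1_le` (`𝒮₁ⁿ`, (6.3)–(6.4), from `BFI.abs_dS1n_le` with two Lemma-3 inputs).
  The `𝒮₂`-term (uniform Poisson error) and `ℛ₁` (§9) are bounded in the sibling files.

Everything here is PROVED; no named facts are introduced (`BFI.MomentHyp`, `BFI.TotMomentHyp` are
parametrised abbreviations of hypotheses, inhabited by `BFI.exists_momentHyp`,
`BFI.exists_totMomentHyp`).

## References

* E. Bombieri, J. B. Friedlander, H. Iwaniec, Acta Math. 156 (1986), 203–251, §3 (3.4)–(3.5),
  §4 (4.2), §5 (5.4), §6 (6.3)–(6.12), §7 (7.1)–(7.5). [BombieriFriedlanderIwaniecActa1986]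
-/

noncomputable section

open Finset Real
open scoped ArithmeticFunction.sigma ArithmeticFunction.omega

namespace Literature.NumberTheory.Sieve

namespace BFI

/-! ## Tools -/

/-- A divisor-moment hypothesis: `∑_{n ≤ X} τ(n)^r ≤ C X (log X)^k` for `X ≥ 2`. [folklore] -/
def MomentHyp (r : ℕ) (C : ℝ) (k : ℕ) : Prop :=
  ∀ X : ℝ, 2 ≤ X → ∑ n ∈ Icc 1 ⌊X⌋₊, (σ 0 n : ℝ) ^ r ≤ C * X * Real.log X ^ k

/-- The moment hypothesis holds for every `r` with some `C > 0`, `k = 2^{r+1}`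
(`DivisorPowerSums`). [cite: MontgomeryVaughan2007, §2.3] -/
theorem exists_momentHyp (r : ℕ) : ∃ C : ℝ, 0 < C ∧ MomentHyp r C (2 ^ (r + 1)) :=
  exists_sum_sigma_zero_pow_le_real r

/-- From `X ≥ 2` to `X ≥ 1`: `∑_{n ≤ X} τ(n)^r ≤ 2C X (log 2X)^k`. [folklore] -/
theorem MomentHyp.sum_le {r : ℕ} {C : ℝ} {k : ℕ} (h : MomentHyp r C k) {X : ℝ}
    (hX : 1 ≤ X) : ∑ n ∈ Icc 1 ⌊X⌋₊, (σ 0 n : ℝ) ^ r ≤ 2 * C * X * Real.log (2 * X) ^ k := by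
  have h2 : (2 : ℝ) ≤ 2 * X := by linarith
  calc ∑ n ∈ Icc 1 ⌊X⌋₊, (σ 0 n : ℝ) ^ r ≤ ∑ n ∈ Icc 1 ⌊2 * X⌋₊, (σ 0 n : ℝ) ^ r := by
        refine Finset.sum_le_sum_of_subset_of_nonneg (Finset.Icc_subset_Icc_right
          (Nat.floor_le_floor (by linarith))) fun _ _ _ => by positivity
    _ ≤ C * (2 * X) * Real.log (2 * X) ^ k := h _ h2
    _ = _ := by ring

/-- **Dyadic divisor moments**: `∑_{q∼Q} τ(q)^r ≤ 4C Q (log 4Q)^k` for `Q ≥ 1/2`. [folklore] -/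
theorem MomentHyp.sum_dyadic_le {r : ℕ} {C : ℝ} {k : ℕ} (h : MomentHyp r C k)
    {Q : ℝ} (hQ : 1 / 2 ≤ Q) : ∑ q ∈ dyadic Q, (σ 0 q : ℝ) ^ r ≤ 4 * C * Q * Real.log (4 * Q) ^ k := by
  have hQ0 : 0 ≤ Q := by linarith
  calc ∑ q ∈ dyadic Q, (σ 0 q : ℝ) ^ r ≤ ∑ n ∈ Icc 1 ⌊2 * Q⌋₊, (σ 0 n : ℝ) ^ r :=
        Finset.sum_le_sum_of_subset_of_nonneg (dyadic_subset_Icc hQ0) fun _ _ _ => by positivity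
    _ ≤ 2 * C * (2 * Q) * Real.log (2 * (2 * Q)) ^ k := h.sum_le (by linarith)
    _ = _ := by ring_nf

/-- `∑_{q∼Q} τ(q)^r / q ≤ 4C (log 4Q)^k` for `Q ≥ 1/2`. [folklore] -/
theorem MomentHyp.sum_dyadic_div_le {r : ℕ} {C : ℝ} {k : ℕ} (h : MomentHyp r C k)
    {Q : ℝ} (hQ : 1 / 2 ≤ Q) :
    ∑ q ∈ dyadic Q, (σ 0 q : ℝ) ^ r / q ≤ 4 * C * Real.log (4 * Q) ^ k := by
  have hQ0 : 0 < Q := by linarith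
  have hlog : 0 ≤ Real.log (4 * Q) := Real.log_nonneg (by linarith)
  calc ∑ q ∈ dyadic Q, (σ 0 q : ℝ) ^ r / q ≤ ∑ q ∈ dyadic Q, (σ 0 q : ℝ) ^ r / Q := by
        refine Finset.sum_le_sum fun q hq => ?_
        have hb := ((mem_dyadic hQ0.le).1 hq).1
        exact div_le_div_of_nonneg_left (by positivity) hQ0 hb.le
    _ = (∑ q ∈ dyadic Q, (σ 0 q : ℝ) ^ r) / Q := by rw [Finset.sum_div]
    _ ≤ (4 * C * Q * Real.log (4 * Q) ^ k) / Q :=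
        div_le_div_of_nonneg_right (h.sum_dyadic_le hQ) hQ0.le
    _ = _ := by field_simp

/-- A totient-weighted moment hypothesis: `∑_{d ≤ X} τ(d)^r/φ(d) ≤ C (log X)^k` for `X ≥ 2`.
[folklore] -/
def TotMomentHyp (r : ℕ) (C : ℝ) (k : ℕ) : Prop :=
  ∀ X : ℝ, 2 ≤ X → ∑ d ∈ Icc 1 ⌊X⌋₊, (σ 0 d : ℝ) ^ r / (Nat.totient d : ℝ) ≤ C * Real.log X ^ k

/-- The totient-weighted hypothesis holds for every `r` (`DivisorPowerSums`). [folklore] -/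
theorem exists_totMomentHyp (r : ℕ) : ∃ C : ℝ, 0 < C ∧ TotMomentHyp r C (2 ^ (r + 2)) :=
  exists_sum_sigma_zero_pow_div_totient_le_real r

/-- `∑_{q∼Q} τ(q)^r/φ(q) ≤ C (log 4Q)^k` for `Q ≥ 1/2`. [folklore] -/
theorem TotMomentHyp.sum_dyadic_le {r : ℕ} {C : ℝ} {k : ℕ} (h : TotMomentHyp r C k)
    {Q : ℝ} (hQ : 1 / 2 ≤ Q) :
    ∑ q ∈ dyadic Q, (σ 0 q : ℝ) ^ r / (Nat.totient q : ℝ) ≤ C * Real.log (4 * Q) ^ k := by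
  have hQ0 : 0 ≤ Q := by linarith
  calc ∑ q ∈ dyadic Q, (σ 0 q : ℝ) ^ r / (Nat.totient q : ℝ)
      ≤ ∑ d ∈ Icc 1 ⌊4 * Q⌋₊, (σ 0 d : ℝ) ^ r / (Nat.totient d : ℝ) := by
        refine Finset.sum_le_sum_of_subset_of_nonneg ((dyadic_subset_Icc hQ0).trans
          (Finset.Icc_subset_Icc_right (Nat.floor_le_floor (by linarith)))) fun _ _ _ => by positivity
    _ ≤ C * Real.log (4 * Q) ^ k := h _ (by linarith)

/-- **Shifted divisor sums**: for `n₁ ∼ N` and `F ≥ 0`,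
`∑_{n₂∼N} F(τ(|n₁−n₂|))·[n₂ ≠ n₁] ≤ 2 ∑_{d ≤ 2N} F(τ(d))` (each `d = |n₁ − n₂| ≥ 1` arises for at
most the two values `n₂ = n₁ ± d`, and `d ≤ 2N`). [folklore] -/
theorem sum_dyadic_shift_le {N : ℝ} (hN : 0 ≤ N) {n₁ : ℕ} (hn₁ : n₁ ∈ dyadic N) (F : ℕ → ℝ)
    (hF : ∀ d, 0 ≤ F d) :
    ∑ n₂ ∈ (dyadic N).filter (fun n₂ => n₂ ≠ n₁), F (Int.natAbs ((n₁ : ℤ) - n₂)) ≤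
      2 * ∑ d ∈ Icc 1 ⌊2 * N⌋₊, F d := by
  classical
  -- fibre decomposition along `d = |n₁ - n₂|`
  set S := (dyadic N).filter (fun n₂ => n₂ ≠ n₁) with hS
  set g : ℕ → ℕ := fun n₂ => Int.natAbs ((n₁ : ℤ) - n₂) with hg
  have hmap : ∀ n₂ ∈ S, g n₂ ∈ Icc 1 ⌊2 * N⌋₊ := by
    intro n₂ hn₂
    rw [hS, Finset.mem_filter] at hn₂
    have hb₁ := (mem_dyadic hN).1 hn₁
    have hb₂ := (mem_dyadic hN).1 hn₂.1
    rw [Finset.mem_Icc]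
    constructor
    · rw [hg]; simp only; rw [Nat.one_le_iff_ne_zero, Int.natAbs_ne_zero]; omega
    · refine Nat.le_floor ?_
      rw [hg]; simp only
      have : ((Int.natAbs ((n₁ : ℤ) - n₂) : ℕ) : ℝ) = |((n₁ : ℝ) - n₂)| := by
        rw [Nat.cast_natAbs]; push_cast; rfl
      rw [this, abs_le]; constructor <;> linarith
  rw [← Finset.sum_fiberwise_of_maps_to hmap]
  rw [Finset.mul_sum]
  refine Finset.sum_le_sum fun d hd => ?_
  have hd1 : 1 ≤ d := (Finset.mem_Icc.1 hd).1
  -- the fibre has at most two elements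
  have hfib : (S.filter (fun n₂ => g n₂ = d)).card ≤ 2 := by
    have hsub : S.filter (fun n₂ => g n₂ = d) ⊆ {n₁ + d, n₁ - d} := by
      intro n₂ hn₂
      rw [Finset.mem_filter] at hn₂
      rw [Finset.mem_insert, Finset.mem_singleton]
      have := hn₂.2; rw [hg] at this; simp only at this
      omega
    exact (Finset.card_le_card hsub).trans (Finset.card_le_two)
  calc ∑ n₂ ∈ S.filter (fun n₂ => g n₂ = d), F (g n₂)
      = ∑ n₂ ∈ S.filter (fun n₂ => g n₂ = d), F d := Finset.sum_congr rfl fun n₂ hn₂ => by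
          rw [(Finset.mem_filter.1 hn₂).2]
    _ = (S.filter (fun n₂ => g n₂ = d)).card * F d := by rw [Finset.sum_const, nsmul_eq_mul]
    _ ≤ 2 * F d := by
        refine mul_le_mul_of_nonneg_right ?_ (hF d); exact_mod_cast hfib

/-- `∑ over ⋃_{i∈S} t i ≤ ∑_i ∑ over t i` for nonnegative summands. [folklore] -/
theorem sum_biUnion_le_of_nonneg {ι κ : Type*} [DecidableEq κ] (S : Finset ι) (t : ι → Finset κ)
    {f : κ → ℝ} (hf : ∀ x, 0 ≤ f x) : ∑ x ∈ S.biUnion t, f x ≤ ∑ i ∈ S, ∑ x ∈ t i, f x := by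
  classical
  induction S using Finset.induction_on with
  | empty => simp
  | insert a S ha ih =>
    rw [Finset.biUnion_insert, Finset.sum_insert ha]
    have hu : ∑ x ∈ t a ∪ S.biUnion t, f x ≤ ∑ x ∈ t a, f x + ∑ x ∈ S.biUnion t, f x := by
      rw [← Finset.sum_union_inter]
      have : 0 ≤ ∑ x ∈ t a ∩ S.biUnion t, f x := Finset.sum_nonneg fun x _ => hf x
      linarith
    exact hu.trans (by linarith)

/-- **Dyadic tails of convergent divisor sums**: under the moment hypothesis, for `1 ≤ Q₀ ≤ X`,
`∑_{Q₀ < q ≤ X} τ(q)^r / q² ≤ 8 C (log 4X)^k / Q₀`. [folklore] -/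
theorem MomentHyp.sum_tail_div_sq_le {r : ℕ} {C : ℝ} {k : ℕ} (h : MomentHyp r C k) (hC : 0 ≤ C)
    {Q₀ X : ℝ} (hQ₀ : 1 ≤ Q₀) (hX : Q₀ ≤ X) :
    ∑ q ∈ (Icc 1 ⌊X⌋₊).filter (fun q : ℕ => Q₀ < (q : ℝ)), (σ 0 q : ℝ) ^ r / (q : ℝ) ^ 2 ≤
      8 * C * Real.log (4 * X) ^ k / Q₀ := by
  classical
  have hQ₀0 : 0 < Q₀ := by linarith
  have hex : ∃ J : ℕ, X ≤ 2 ^ J * Q₀ := by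
    obtain ⟨J, hJ⟩ := pow_unbounded_of_one_lt (X / Q₀) (by norm_num : (1 : ℝ) < 2)
    exact ⟨J, by rw [div_lt_iff₀ hQ₀0] at hJ; linarith⟩
  set J := Nat.find hex with hJdef
  have hJ : X ≤ 2 ^ J * Q₀ := Nat.find_spec hex
  have hJmin : ∀ j, j < J → 2 ^ j * Q₀ < X := fun j hj => by
    have := Nat.find_min hex hj; rw [not_le] at this; exact this
  have hlog4X : 0 ≤ Real.log (4 * X) := Real.log_nonneg (by linarith)
  -- cover `(Q₀, X]` by the dyadic ranges `(2^j Q₀, 2^{j+1} Q₀]`, `j < J`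
  have hcover : (Icc 1 ⌊X⌋₊).filter (fun q : ℕ => Q₀ < (q : ℝ)) ⊆
      (Finset.range J).biUnion (fun j => dyadic (2 ^ j * Q₀)) := by
    intro q hq
    rw [Finset.mem_filter, Finset.mem_Icc] at hq
    obtain ⟨⟨_, hqX⟩, hqQ⟩ := hq
    have hqX' : (q : ℝ) ≤ X := le_trans (by exact_mod_cast hqX) (Nat.floor_le (by linarith))
    have hex' : ∃ j : ℕ, (q : ℝ) ≤ 2 ^ (j + 1) * Q₀ := ⟨J, hqX'.trans (hJ.trans (by
      rw [pow_succ]; nlinarith [pow_pos (show (0:ℝ) < 2 by norm_num) J]))⟩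
    set j := Nat.find hex' with hjdef
    have hj : (q : ℝ) ≤ 2 ^ (j + 1) * Q₀ := Nat.find_spec hex'
    have hjlow : 2 ^ j * Q₀ < q := by
      rcases Nat.eq_zero_or_pos j with hj0 | hjpos
      · rw [hj0, pow_zero, one_mul]; exact hqQ
      · have := Nat.find_min hex' (m := j - 1) (by omega)
        rw [not_le, show j - 1 + 1 = j by omega] at this
        exact this
    rw [Finset.mem_biUnion]
    refine ⟨j, ?_, ?_⟩
    · rw [Finset.mem_range]
      by_contra hjJ
      rw [not_lt] at hjJ
      have : (2 : ℝ) ^ J * Q₀ ≤ 2 ^ j * Q₀ :=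
        mul_le_mul_of_nonneg_right (pow_le_pow_right₀ (by norm_num) hjJ) hQ₀0.le
      linarith
    · rw [mem_dyadic (by positivity)]
      exact ⟨hjlow, by rw [pow_succ] at hj; linarith⟩
  have hblock : ∀ j ∈ Finset.range J, ∑ q ∈ dyadic (2 ^ j * Q₀), (σ 0 q : ℝ) ^ r / (q : ℝ) ^ 2 ≤
      (2 ^ j * Q₀)⁻¹ * (4 * C * Real.log (4 * X) ^ k) := by
    intro j hj
    have hjJ := Finset.mem_range.1 hj
    have hQj0 : 0 < 2 ^ j * Q₀ := by positivity
    have hQj : 1 / 2 ≤ 2 ^ j * Q₀ := by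
      have : (1 : ℝ) ≤ 2 ^ j := one_le_pow₀ (by norm_num); nlinarith
    have hle : 2 ^ j * Q₀ ≤ X := (hJmin j hjJ).le
    calc ∑ q ∈ dyadic (2 ^ j * Q₀), (σ 0 q : ℝ) ^ r / (q : ℝ) ^ 2
        ≤ ∑ q ∈ dyadic (2 ^ j * Q₀), (2 ^ j * Q₀)⁻¹ * ((σ 0 q : ℝ) ^ r / q) := by
          refine Finset.sum_le_sum fun q hq => ?_
          have hb := ((mem_dyadic hQj0.le).1 hq).1
          have hq0 : (0 : ℝ) < q := by linarith
          rw [show (σ 0 q : ℝ) ^ r / (q : ℝ) ^ 2 = (q : ℝ)⁻¹ * ((σ 0 q : ℝ) ^ r / q) by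
            field_simp]
          exact mul_le_mul_of_nonneg_right (inv_anti₀ hQj0 hb.le) (by positivity)
      _ = (2 ^ j * Q₀)⁻¹ * ∑ q ∈ dyadic (2 ^ j * Q₀), (σ 0 q : ℝ) ^ r / q := by rw [Finset.mul_sum]
      _ ≤ (2 ^ j * Q₀)⁻¹ * (4 * C * Real.log (4 * (2 ^ j * Q₀)) ^ k) :=
          mul_le_mul_of_nonneg_left (h.sum_dyadic_div_le hQj) (by positivity)
      _ ≤ (2 ^ j * Q₀)⁻¹ * (4 * C * Real.log (4 * X) ^ k) := by
          have h1 : Real.log (4 * (2 ^ j * Q₀)) ≤ Real.log (4 * X) :=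
            Real.log_le_log (by positivity) (by linarith)
          have h0 : 0 ≤ Real.log (4 * (2 ^ j * Q₀)) := Real.log_nonneg (by linarith)
          gcongr
  have hgeom : ∑ j ∈ Finset.range J, ((2 : ℝ) ^ j)⁻¹ ≤ 2 := by
    have := geom_sum_Ico_le_of_lt_one (show (0:ℝ) ≤ 1/2 by norm_num) (show (1:ℝ)/2 < 1 by norm_num)
      (m := 0) (n := J)
    norm_num at this
    refine le_trans (le_of_eq (Finset.sum_congr rfl fun j _ => ?_)) this
    rw [one_div, inv_pow]
  calc ∑ q ∈ (Icc 1 ⌊X⌋₊).filter (fun q : ℕ => Q₀ < (q : ℝ)), (σ 0 q : ℝ) ^ r / (q : ℝ) ^ 2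
      ≤ ∑ q ∈ (Finset.range J).biUnion (fun j => dyadic (2 ^ j * Q₀)), (σ 0 q : ℝ) ^ r / (q : ℝ) ^ 2 :=
        Finset.sum_le_sum_of_subset_of_nonneg hcover fun _ _ _ => by positivity
    _ ≤ ∑ j ∈ Finset.range J, ∑ q ∈ dyadic (2 ^ j * Q₀), (σ 0 q : ℝ) ^ r / (q : ℝ) ^ 2 :=
        sum_biUnion_le_of_nonneg _ _ fun _ => by positivity
    _ ≤ ∑ j ∈ Finset.range J, (2 ^ j * Q₀)⁻¹ * (4 * C * Real.log (4 * X) ^ k) :=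
        Finset.sum_le_sum hblock
    _ = (4 * C * Real.log (4 * X) ^ k / Q₀) * ∑ j ∈ Finset.range J, ((2 : ℝ) ^ j)⁻¹ := by
        rw [Finset.mul_sum]
        refine Finset.sum_congr rfl fun j _ => ?_
        rw [mul_inv]; field_simp
    _ ≤ (4 * C * Real.log (4 * X) ^ k / Q₀) * 2 :=
        mul_le_mul_of_nonneg_left hgeom (by positivity)
    _ = _ := by ring


/-! ## Skeleton -/

/-- **The dispersion skeleton for Theorem 2.**  For `0 < Y ≤ M` (weight `f = bump M Y`,
`S = mRange M Y`), every `Q₀`, `H` and every auxiliary sequence `β'` (downstream `β' = μ²β`):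
`𝒢 ≤ |𝒮₁ⁿ| + |𝒮₁ᶜ(β) − 𝒮₁ᶜ(β')| + ‖𝒮₁ᶜ(β') − α̂₀𝒳(β') − ℛ₁(β')‖ + ‖ℛ₁(β')‖ + ‖α̂₀‖|𝒳(β) − 𝒳(β')|
  + ‖α̂₀‖|𝒳(β) − X(β)| + 2‖𝒮₂ − α̂₀X‖ + ‖𝒮₃ − α̂₀X‖`
(smoothing (3.4): `𝒢 ≤ 𝒮₁ − 2𝒮₂ + 𝒮₃`; `𝒮₁ = 𝒮₁ᶜ + 𝒮₁ⁿ`; the main terms `α̂₀X` cancel exactly).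
[cite: BombieriFriedlanderIwaniecActa1986, §3 (3.4)–(3.5) p. 215, §6 (6.11), §7 (7.1)] -/
theorem dispG_le_errors (a : ℤ) {M Y : ℝ} (hY : 0 < Y) (hYM : Y ≤ M) (N Q R Q₀ : ℝ)
    (β β' γ : ℕ → ℝ) (H : ℕ) :
    dispG a M N Q R β γ ≤
      |dS1n a (mRange M Y) N Q R Q₀ (fun m => bump M Y m) β γ| +
      |dS1c a (mRange M Y) N Q R Q₀ (fun m => bump M Y m) β γ -
          dS1c a (mRange M Y) N Q R Q₀ (fun m => bump M Y m) β' γ| +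
      ‖(dS1c a (mRange M Y) N Q R Q₀ (fun m => bump M Y m) β' γ : ℂ) -
          alphaHat M Y * (calX a N Q R Q₀ β' γ : ℂ) - calR1 a M Y N Q R Q₀ β' γ H‖ +
      ‖calR1 a M Y N Q R Q₀ β' γ H‖ +
      ‖alphaHat M Y‖ * |calX a N Q R Q₀ β γ - calX a N Q R Q₀ β' γ| +
      ‖alphaHat M Y‖ * |calX a N Q R Q₀ β γ - mainX a N Q R β γ| +
      2 * ‖(dS2 a (mRange M Y) N Q R (fun m => bump M Y m) β γ : ℂ) -
          alphaHat M Y * (mainX a N Q R β γ : ℂ)‖ +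
      ‖(dS3 a (mRange M Y) N Q R (fun m => bump M Y m) β γ : ℂ) -
          alphaHat M Y * (mainX a N Q R β γ : ℂ)‖ := by
  have hM : 0 ≤ M := hY.le.trans hYM
  set S := mRange M Y
  set f : ℕ → ℝ := fun m => bump M Y m
  -- abbreviations
  set s1c := dS1c a S N Q R Q₀ f β γ
  set s1c' := dS1c a S N Q R Q₀ f β' γ
  set s1n := dS1n a S N Q R Q₀ f β γ
  set s2 := dS2 a S N Q R f β γ
  set s3 := dS3 a S N Q R f β γ
  set X := mainX a N Q R β γ
  set cX := calX a N Q R Q₀ β γ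
  set cX' := calX a N Q R Q₀ β' γ
  set R1 := calR1 a M Y N Q R Q₀ β' γ H
  set α := alphaHat M Y
  have h1 : dispG a M N Q R β γ ≤ s1c + s1n - 2 * s2 + s3 := by
    have := dispG_le_dispGw_bump a hY hM N Q R β γ
    rw [dispGw_eq_dS, dS1_eq_dS1c_add_dS1n a S N Q R Q₀] at this
    exact this
  -- the complex identity
  set T : ℂ := ((s1c' : ℂ) - α * (cX' : ℂ) - R1) + R1 + α * ((cX' : ℂ) - (cX : ℂ)) +
    α * ((cX : ℂ) - (X : ℂ)) - 2 * ((s2 : ℂ) - α * (X : ℂ)) + ((s3 : ℂ) - α * (X : ℂ)) with hT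
  have hTe : T = ((s1c' - 2 * s2 + s3 : ℝ) : ℂ) := by
    rw [hT]; push_cast; ring
  have hre : s1c' - 2 * s2 + s3 ≤ ‖T‖ := by
    have : (T.re : ℝ) = s1c' - 2 * s2 + s3 := by rw [hTe, Complex.ofReal_re]
    rw [← this]; exact Complex.re_le_norm T
  have hTn : ‖T‖ ≤ ‖(s1c' : ℂ) - α * (cX' : ℂ) - R1‖ + ‖R1‖ + ‖α‖ * |cX - cX'| + ‖α‖ * |cX - X| +
      2 * ‖(s2 : ℂ) - α * (X : ℂ)‖ + ‖(s3 : ℂ) - α * (X : ℂ)‖ := by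
    rw [hT]
    have e3 : ‖α * ((cX' : ℂ) - (cX : ℂ))‖ = ‖α‖ * |cX - cX'| := by
      rw [norm_mul, ← Complex.ofReal_sub, Complex.norm_real, Real.norm_eq_abs, abs_sub_comm]
    have e4 : ‖α * ((cX : ℂ) - (X : ℂ))‖ = ‖α‖ * |cX - X| := by
      rw [norm_mul, ← Complex.ofReal_sub, Complex.norm_real, Real.norm_eq_abs]
    have e5 : ‖(2 : ℂ) * ((s2 : ℂ) - α * (X : ℂ))‖ = 2 * ‖(s2 : ℂ) - α * (X : ℂ)‖ := by
      rw [norm_mul]; norm_num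
    calc _ ≤ ‖((s1c' : ℂ) - α * (cX' : ℂ) - R1) + R1 + α * ((cX' : ℂ) - (cX : ℂ)) +
          α * ((cX : ℂ) - (X : ℂ)) - 2 * ((s2 : ℂ) - α * (X : ℂ))‖ + ‖(s3 : ℂ) - α * (X : ℂ)‖ :=
          norm_add_le _ _
      _ ≤ ‖((s1c' : ℂ) - α * (cX' : ℂ) - R1) + R1 + α * ((cX' : ℂ) - (cX : ℂ)) +
          α * ((cX : ℂ) - (X : ℂ))‖ + ‖(2 : ℂ) * ((s2 : ℂ) - α * (X : ℂ))‖ + ‖(s3 : ℂ) - α * (X : ℂ)‖ := by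
          gcongr; exact norm_sub_le _ _
      _ ≤ ‖((s1c' : ℂ) - α * (cX' : ℂ) - R1) + R1 + α * ((cX' : ℂ) - (cX : ℂ))‖ +
          ‖α * ((cX : ℂ) - (X : ℂ))‖ + ‖(2 : ℂ) * ((s2 : ℂ) - α * (X : ℂ))‖ + ‖(s3 : ℂ) - α * (X : ℂ)‖ := by
          gcongr; exact norm_add_le _ _
      _ ≤ ‖((s1c' : ℂ) - α * (cX' : ℂ) - R1) + R1‖ + ‖α * ((cX' : ℂ) - (cX : ℂ))‖ +
          ‖α * ((cX : ℂ) - (X : ℂ))‖ + ‖(2 : ℂ) * ((s2 : ℂ) - α * (X : ℂ))‖ + ‖(s3 : ℂ) - α * (X : ℂ)‖ := by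
          gcongr; exact norm_add_le _ _
      _ ≤ ‖(s1c' : ℂ) - α * (cX' : ℂ) - R1‖ + ‖R1‖ + ‖α * ((cX' : ℂ) - (cX : ℂ))‖ +
          ‖α * ((cX : ℂ) - (X : ℂ))‖ + ‖(2 : ℂ) * ((s2 : ℂ) - α * (X : ℂ))‖ + ‖(s3 : ℂ) - α * (X : ℂ)‖ := by
          gcongr; exact norm_add_le _ _
      _ = _ := by rw [e3, e4, e5]
  have h2 : s1c ≤ |s1c - s1c'| + s1c' := by
    have := le_abs_self (s1c - s1c'); linarith
  have h3 : s1n ≤ |s1n| := le_abs_self _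
  linarith


/-! ## E8 and E7: the errors of `𝒮₃` and `𝒮₂` -/

/-- Factorisation of a separable triple sum. [folklore] -/
theorem sum₃_mul_eq (A B C : Finset ℕ) (f g h : ℕ → ℝ) (K : ℝ) :
    ∑ r ∈ A, ∑ q₁ ∈ B, ∑ q₂ ∈ C, K * (f q₁ * g q₂ * h r) =
      K * ((∑ q ∈ B, f q) * (∑ q ∈ C, g q) * ∑ r ∈ A, h r) := by
  have e : ∀ r, ∑ q₁ ∈ B, ∑ q₂ ∈ C, K * (f q₁ * g q₂ * h r) =
      K * h r * ((∑ q ∈ B, f q) * ∑ q ∈ C, g q) := by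
    intro r
    rw [Finset.sum_mul_sum, Finset.mul_sum]
    refine Finset.sum_congr rfl fun q₁ _ => ?_
    rw [Finset.mul_sum]
    refine Finset.sum_congr rfl fun q₂ _ => by ring
  simp_rw [e]
  rw [← Finset.sum_mul, ← Finset.mul_sum]
  ring


/-- `|γ_q| ≤ τ(q)^b` gives `|γ_{q₁}||γ_{q₂}| τ(q₁q₂r)/(φ(q₁r)φ(q₂r)) ≤ τ(q₁)^{b+2}/q₁ · τ(q₂)^{b+2}/q₂ · τ(r)³/r²`
(`τ` submultiplicative, `1/φ(qr) ≤ τ(q)τ(r)/(qr)`). [folklore] -/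
theorem s3_weight_le {γ : ℕ → ℝ} {b : ℕ} (hγ : ∀ q, |γ q| ≤ (σ 0 q : ℝ) ^ b) {q₁ q₂ r : ℕ}
    (hq₁ : 0 < q₁) (hq₂ : 0 < q₂) (hr : 0 < r) :
    |γ q₁| * |γ q₂| * (σ 0 (q₁ * q₂ * r) : ℝ) / ((Nat.totient (q₁ * r) : ℝ) * (Nat.totient (q₂ * r) : ℝ)) ≤
      ((σ 0 q₁ : ℝ) ^ (b + 2) / q₁) * ((σ 0 q₂ : ℝ) ^ (b + 2) / q₂) * ((σ 0 r : ℝ) ^ 3 / (r : ℝ) ^ 2) := by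
  have hφ₁ := inv_totient_mul_le hq₁ hr
  have hφ₂ := inv_totient_mul_le hq₂ hr
  have hτ : (σ 0 (q₁ * q₂ * r) : ℝ) ≤ (σ 0 q₁ : ℝ) * (σ 0 q₂ : ℝ) * (σ 0 r : ℝ) := by
    have h1 := sigma_zero_mul_le (q₁ * q₂) r
    have h2 := sigma_zero_mul_le q₁ q₂
    calc (σ 0 (q₁ * q₂ * r) : ℝ) ≤ ((σ 0 (q₁ * q₂) * σ 0 r : ℕ) : ℝ) := by exact_mod_cast h1
      _ ≤ ((σ 0 q₁ * σ 0 q₂ * σ 0 r : ℕ) : ℝ) := by exact_mod_cast Nat.mul_le_mul_right _ h2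
      _ = _ := by push_cast; ring
  have hφpos₁ : (0 : ℝ) < (Nat.totient (q₁ * r) : ℝ) := by exact_mod_cast Nat.totient_pos.2 (Nat.mul_pos hq₁ hr)
  have hφpos₂ : (0 : ℝ) < (Nat.totient (q₂ * r) : ℝ) := by exact_mod_cast Nat.totient_pos.2 (Nat.mul_pos hq₂ hr)
  rw [div_eq_mul_inv, mul_inv]
  have hq₁0 : (0 : ℝ) < q₁ := by exact_mod_cast hq₁
  have hq₂0 : (0 : ℝ) < q₂ := by exact_mod_cast hq₂
  have hr0 : (0 : ℝ) < r := by exact_mod_cast hr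
  have hτ₁ : (1 : ℝ) ≤ (σ 0 q₁ : ℝ) := by exact_mod_cast one_le_sigma_zero hq₁.ne'
  have hτ₂ : (1 : ℝ) ≤ (σ 0 q₂ : ℝ) := by exact_mod_cast one_le_sigma_zero hq₂.ne'
  have hA : |γ q₁| * |γ q₂| ≤ (σ 0 q₁ : ℝ) ^ b * (σ 0 q₂ : ℝ) ^ b :=
    mul_le_mul (hγ q₁) (hγ q₂) (abs_nonneg _) (by positivity)
  have hB : ((Nat.totient (q₁ * r) : ℝ))⁻¹ * ((Nat.totient (q₂ * r) : ℝ))⁻¹ ≤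
      ((σ 0 q₁ : ℝ) * (σ 0 r : ℝ) / ((q₁ : ℝ) * r)) * ((σ 0 q₂ : ℝ) * (σ 0 r : ℝ) / ((q₂ : ℝ) * r)) :=
    mul_le_mul hφ₁ hφ₂ (inv_nonneg.2 hφpos₂.le) (by positivity)
  calc |γ q₁| * |γ q₂| * (σ 0 (q₁ * q₂ * r) : ℝ) *
        (((Nat.totient (q₁ * r) : ℝ))⁻¹ * ((Nat.totient (q₂ * r) : ℝ))⁻¹)
      ≤ (σ 0 q₁ : ℝ) ^ b * (σ 0 q₂ : ℝ) ^ b * ((σ 0 q₁ : ℝ) * (σ 0 q₂ : ℝ) * (σ 0 r : ℝ)) *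
        (((σ 0 q₁ : ℝ) * (σ 0 r : ℝ) / ((q₁ : ℝ) * r)) * ((σ 0 q₂ : ℝ) * (σ 0 r : ℝ) / ((q₂ : ℝ) * r))) := by
        refine mul_le_mul (mul_le_mul hA hτ (by positivity) (by positivity)) hB
          (mul_nonneg (inv_nonneg.2 hφpos₁.le) (inv_nonneg.2 hφpos₂.le)) (by positivity)
    _ = _ := by field_simp; ring

/-- **E8** (BFI (4.2): "`ℛ₃ ≪ N‖β‖²R⁻¹ℒ^B` which is admissible"): with `|γ_q| ≤ τ(q)^b` and the
divisor moments `∑_{n≤X}τ^{b+2} ≤ C₁X(log X)^{k₁}`, `∑τ³ ≤ C₃X(log X)^{k₃}`, for `Q, R ≥ 1/2`,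
`‖𝒮₃ − α̂₀X‖ ≤ (2(M+2Y)/Y + K₂)(2N+1)‖β‖² (4C₁(log 4Q)^{k₁})² (4C₃(log 4R)^{k₃})/R`.
[cite: BombieriFriedlanderIwaniecActa1986, §4 (4.2) p. 216] -/
theorem e8_le {M Y : ℝ} (hY : 0 < Y) (hYM : Y ≤ M) (a : ℤ) {N Q R : ℝ} (hN : 0 ≤ N)
    (hQ : 1 / 2 ≤ Q) (hR : 1 / 2 ≤ R) (β : ℕ → ℝ) {γ : ℕ → ℝ} {b : ℕ}
    (hγ : ∀ q, |γ q| ≤ (σ 0 q : ℝ) ^ b) {C₁ C₃ : ℝ} {k₁ k₃ : ℕ} (h₁ : MomentHyp (b + 2) C₁ k₁)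
    (h₃ : MomentHyp 3 C₃ k₃) :
    ‖(dS3 a (mRange M Y) N Q R (fun m => bump M Y m) β γ : ℂ) - alphaHat M Y * (mainX a N Q R β γ : ℂ)‖ ≤
      (2 * (M + 2 * Y) / Y + derivConst 2) * ((2 * N + 1) * l2Sq N β) *
        (4 * C₁ * Real.log (4 * Q) ^ k₁) ^ 2 * (4 * C₃ * Real.log (4 * R) ^ k₃ / R) := by
  have hQ0 : 0 < Q := by linarith
  have hR0 : 0 < R := by linarith
  have hK : 0 ≤ 2 * (M + 2 * Y) / Y + derivConst 2 := by
    have := one_le_derivConst 2; have hM : 0 ≤ M := hY.le.trans hYM; positivity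
  refine (norm_dS3_sub_mainX_le hY hYM a hQ0.le hR0.le β γ).trans ?_
  rw [mul_assoc, mul_assoc]
  refine mul_le_mul_of_nonneg_left ?_ hK
  -- `(∑|β|)² ≤ (2N+1) S₂`
  have hβ : (∑ n ∈ dyadic N, |β n|) ^ 2 ≤ (2 * N + 1) * l2Sq N β := by
    have h := sum_abs_le_sqrt_l2Sq hN β
    have h0 : 0 ≤ ∑ n ∈ dyadic N, |β n| := Finset.sum_nonneg fun _ _ => abs_nonneg _
    calc (∑ n ∈ dyadic N, |β n|) ^ 2 ≤ (Real.sqrt (l2Sq N β) * Real.sqrt (2 * N + 1)) ^ 2 :=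
          pow_le_pow_left₀ h0 h 2
      _ = (2 * N + 1) * l2Sq N β := by
          rw [mul_pow, Real.sq_sqrt (l2Sq_nonneg N β), Real.sq_sqrt (by linarith)]; ring
  -- termwise
  have hterm : ∀ r ∈ dyadic R, ∀ q₁ ∈ dyadic Q, ∀ q₂ ∈ dyadic Q,
      |γ q₁| * |γ q₂| * (σ 0 (q₁ * q₂ * r) : ℝ) * (∑ n ∈ dyadic N, |β n|) ^ 2 /
          ((Nat.totient (q₁ * r) : ℝ) * (Nat.totient (q₂ * r) : ℝ)) ≤
        ((2 * N + 1) * l2Sq N β) * (((σ 0 q₁ : ℝ) ^ (b + 2) / q₁) * ((σ 0 q₂ : ℝ) ^ (b + 2) / q₂) *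
          ((σ 0 r : ℝ) ^ 3 / (r : ℝ) ^ 2)) := by
    intro r hr q₁ hq₁ q₂ hq₂
    have hw := s3_weight_le hγ (pos_of_mem_dyadic hQ0.le hq₁) (pos_of_mem_dyadic hQ0.le hq₂)
      (pos_of_mem_dyadic hR0.le hr)
    have hw0 : 0 ≤ |γ q₁| * |γ q₂| * (σ 0 (q₁ * q₂ * r) : ℝ) /
        ((Nat.totient (q₁ * r) : ℝ) * (Nat.totient (q₂ * r) : ℝ)) := by positivity
    calc _ = (∑ n ∈ dyadic N, |β n|) ^ 2 * (|γ q₁| * |γ q₂| * (σ 0 (q₁ * q₂ * r) : ℝ) /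
          ((Nat.totient (q₁ * r) : ℝ) * (Nat.totient (q₂ * r) : ℝ))) := by ring
      _ ≤ _ := mul_le_mul hβ hw hw0 (by have := l2Sq_nonneg N β; positivity)
  calc _ ≤ ∑ r ∈ dyadic R, ∑ q₁ ∈ dyadic Q, ∑ q₂ ∈ dyadic Q,
        ((2 * N + 1) * l2Sq N β) * (((σ 0 q₁ : ℝ) ^ (b + 2) / q₁) * ((σ 0 q₂ : ℝ) ^ (b + 2) / q₂) *
          ((σ 0 r : ℝ) ^ 3 / (r : ℝ) ^ 2)) :=
        Finset.sum_le_sum fun r hr => Finset.sum_le_sum fun q₁ hq₁ => Finset.sum_le_sum fun q₂ hq₂ =>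
          hterm r hr q₁ hq₁ q₂ hq₂
    _ = ((2 * N + 1) * l2Sq N β) * ((∑ q ∈ dyadic Q, (σ 0 q : ℝ) ^ (b + 2) / q) ^ 2 *
          ∑ r ∈ dyadic R, (σ 0 r : ℝ) ^ 3 / (r : ℝ) ^ 2) := by
        rw [sum₃_mul_eq]; ring
    _ ≤ ((2 * N + 1) * l2Sq N β) * ((4 * C₁ * Real.log (4 * Q) ^ k₁) ^ 2 *
          (4 * C₃ * Real.log (4 * R) ^ k₃ / R)) := by
        have hl2 := l2Sq_nonneg N β
        refine mul_le_mul_of_nonneg_left ?_ (by positivity)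
        have hA := h₁.sum_dyadic_div_le hQ
        have hA0 : 0 ≤ ∑ q ∈ dyadic Q, (σ 0 q : ℝ) ^ (b + 2) / q :=
          Finset.sum_nonneg fun _ _ => by positivity
        have hB : ∑ r ∈ dyadic R, (σ 0 r : ℝ) ^ 3 / (r : ℝ) ^ 2 ≤ 4 * C₃ * Real.log (4 * R) ^ k₃ / R := by
          calc ∑ r ∈ dyadic R, (σ 0 r : ℝ) ^ 3 / (r : ℝ) ^ 2
              ≤ ∑ r ∈ dyadic R, R⁻¹ * ((σ 0 r : ℝ) ^ 3 / r) := by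
                refine Finset.sum_le_sum fun r hr => ?_
                have hb := ((mem_dyadic hR0.le).1 hr).1
                have hr0 : (0 : ℝ) < r := by linarith
                rw [show (σ 0 r : ℝ) ^ 3 / (r : ℝ) ^ 2 = (r : ℝ)⁻¹ * ((σ 0 r : ℝ) ^ 3 / r) by field_simp]
                exact mul_le_mul_of_nonneg_right (inv_anti₀ hR0 hb.le) (by positivity)
            _ = R⁻¹ * ∑ r ∈ dyadic R, (σ 0 r : ℝ) ^ 3 / r := by rw [Finset.mul_sum]
            _ ≤ R⁻¹ * (4 * C₃ * Real.log (4 * R) ^ k₃) :=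
                mul_le_mul_of_nonneg_left (h₃.sum_dyadic_div_le hR) (by positivity)
            _ = _ := by rw [inv_mul_eq_div]
        have hB0 : 0 ≤ ∑ r ∈ dyadic R, (σ 0 r : ℝ) ^ 3 / (r : ℝ) ^ 2 :=
          Finset.sum_nonneg fun _ _ => by positivity
        exact mul_le_mul (pow_le_pow_left₀ hA0 hA 2) hB hB0 (by positivity)
    _ = _ := by ring

/-! ## E5: `α̂₀ (𝒳(β) − 𝒳(β♭))` -/

/-- `(∑_{q∼Q} |γ_q|)² ≤ (4C_bQ(log 4Q)^{k_b})²` under `|γ_q| ≤ τ(q)^b`. [folklore] -/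
theorem sum_abs_gamma_sq_le {γ : ℕ → ℝ} {b : ℕ} (hγ : ∀ q, |γ q| ≤ (σ 0 q : ℝ) ^ b) {Cb : ℝ} {kb : ℕ}
    (hb : MomentHyp b Cb kb) {Q : ℝ} (hQ : 1 / 2 ≤ Q) :
    (∑ q ∈ dyadic Q, |γ q|) ^ 2 ≤ (4 * Cb * Q * Real.log (4 * Q) ^ kb) ^ 2 := by
  have h0 : 0 ≤ ∑ q ∈ dyadic Q, |γ q| := Finset.sum_nonneg fun _ _ => abs_nonneg _
  refine pow_le_pow_left₀ h0 ((Finset.sum_le_sum fun q _ => hγ q).trans (hb.sum_dyadic_le hQ)) 2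

/-- The shifted divisor sums of `BFI.abs_calX_sub_calX_sqfPart_le`: for `n₁ ∼ N` (`N ≥ 1/2`),
`∑_{n₂∼N} τ(|n₁−n₂|)^r ≤ 8 C N (1 + log 4N)^k` under the moment hypothesis for `τ^r`. [folklore] -/
theorem sum_tauDiff_pow_le {N : ℝ} (hN : 1 / 2 ≤ N) {n₁ : ℕ} (hn₁ : n₁ ∈ dyadic N) {r : ℕ} (hr : r ≠ 0)
    {C : ℝ} {k : ℕ} (h : MomentHyp r C k) (hC : 0 ≤ C) :
    ∑ n₂ ∈ dyadic N, tauDiff n₁ n₂ ^ r ≤ 8 * C * N * (1 + Real.log (4 * N)) ^ k := by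
  have hN0 : 0 ≤ N := by linarith
  have hsplit : ∑ n₂ ∈ dyadic N, tauDiff n₁ n₂ ^ r =
      ∑ n₂ ∈ (dyadic N).filter (fun n₂ => n₂ ≠ n₁), tauDiff n₁ n₂ ^ r := by
    rw [Finset.sum_filter]
    refine Finset.sum_congr rfl fun n₂ _ => ?_
    by_cases hne : n₂ ≠ n₁
    · rw [if_pos hne]
    · have hne' : n₂ = n₁ := not_not.1 hne
      rw [if_neg hne, hne']
      unfold tauDiff; simp [hr]
  rw [hsplit]
  have h1 := sum_dyadic_shift_le hN0 hn₁ (fun d => ((σ 0 d : ℝ)) ^ r) (fun d => by positivity)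
  unfold tauDiff
  refine h1.trans ?_
  have h2 := h.sum_le (X := 2 * N) (by linarith)
  have hlog : Real.log (2 * (2 * N)) ≤ 1 + Real.log (4 * N) := by
    rw [show 2 * (2 * N) = 4 * N by ring]; linarith
  have hlog0 : 0 ≤ Real.log (2 * (2 * N)) := Real.log_nonneg (by linarith)
  calc 2 * ∑ d ∈ Icc 1 ⌊2 * N⌋₊, (σ 0 d : ℝ) ^ r ≤ 2 * (2 * C * (2 * N) * Real.log (2 * (2 * N)) ^ k) := by
        linarith
    _ ≤ 2 * (2 * C * (2 * N) * (1 + Real.log (4 * N)) ^ k) := by gcongr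
    _ = _ := by ring

/-- The numerics of E5: from `T₁ ≤ 8C₁NΛ`, `T₂ ≤ 8C₂NΛ`, `Nn ≤ 4N/z` (`Λ ≥ 1`, `z ≥ 1`):
`(T₁ (Nn T₂)^{1/2})^{1/2} ≤ (8C₁ (32C₂)^{1/2})^{1/2} N Λ / z^{1/4}`. [folklore] -/
theorem e5_numerics {T₁ T₂ Nn N Λ z C₁ C₂ : ℝ} (hN : 0 ≤ N) (hΛ : 1 ≤ Λ) (hz : 1 ≤ z)
    (hC₁ : 0 ≤ C₁) (hC₂ : 0 ≤ C₂) (hT₂0 : 0 ≤ T₂)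
    (hT₁ : T₁ ≤ 8 * C₁ * N * Λ) (hT₂ : T₂ ≤ 8 * C₂ * N * Λ) (hNn : Nn ≤ 4 * N / z) :
    Real.sqrt (T₁ * Real.sqrt (Nn * T₂)) ≤
      Real.sqrt (8 * C₁ * Real.sqrt (32 * C₂)) * N * Λ / Real.sqrt (Real.sqrt z) := by
  have hz0 : 0 < z := by linarith
  have hsz : 0 < Real.sqrt z := Real.sqrt_pos.2 hz0
  have hssz : 0 < Real.sqrt (Real.sqrt z) := Real.sqrt_pos.2 hsz
  -- `Nn T₂ ≤ 32 C₂ N² Λ / z ≤ (32C₂/z) (N Λ)²`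
  have h1 : Nn * T₂ ≤ (32 * C₂ / z) * (N * Λ) ^ 2 := by
    calc Nn * T₂ ≤ (4 * N / z) * (8 * C₂ * N * Λ) := mul_le_mul hNn hT₂ hT₂0 (by positivity)
      _ = (32 * C₂ / z) * (N * N * Λ) := by ring
      _ ≤ (32 * C₂ / z) * (N * Λ) ^ 2 := by
          refine mul_le_mul_of_nonneg_left ?_ (by positivity)
          rw [sq]; have : N * Λ * (N * Λ) = N * N * Λ * Λ := by ring
          rw [this]; exact le_mul_of_one_le_right (by positivity) hΛ
  have h2 : Real.sqrt (Nn * T₂) ≤ Real.sqrt (32 * C₂) / Real.sqrt z * (N * Λ) := by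
    calc Real.sqrt (Nn * T₂) ≤ Real.sqrt ((32 * C₂ / z) * (N * Λ) ^ 2) := Real.sqrt_le_sqrt h1
      _ = _ := by
          rw [Real.sqrt_mul (by positivity), Real.sqrt_sq (by positivity), Real.sqrt_div (by positivity)]
  have h3 : T₁ * Real.sqrt (Nn * T₂) ≤ (8 * C₁ * Real.sqrt (32 * C₂) / Real.sqrt z) * (N * Λ) ^ 2 := by
    calc T₁ * Real.sqrt (Nn * T₂) ≤ (8 * C₁ * N * Λ) * (Real.sqrt (32 * C₂) / Real.sqrt z * (N * Λ)) :=
          mul_le_mul hT₁ h2 (Real.sqrt_nonneg _) (by positivity)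
      _ = _ := by ring
  calc Real.sqrt (T₁ * Real.sqrt (Nn * T₂))
      ≤ Real.sqrt ((8 * C₁ * Real.sqrt (32 * C₂) / Real.sqrt z) * (N * Λ) ^ 2) := Real.sqrt_le_sqrt h3
    _ = Real.sqrt (8 * C₁ * Real.sqrt (32 * C₂)) / Real.sqrt (Real.sqrt z) * (N * Λ) := by
        rw [Real.sqrt_mul (by positivity), Real.sqrt_sq (by positivity), Real.sqrt_div (by positivity)]
    _ = _ := by ring

/-- **E5** (BFI (7.1) for the squarefree reduction): with `|γ_q| ≤ τ(q)^b`, (A₄) at level `z ≥ 1`,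
and the moments for `τ^b`, `τ`, `τ²`, for `N, Q ≥ 1/2`, `R, Q₀ > 0`,
`‖α̂₀‖ |𝒳(β) − 𝒳(β♭)| ≤ (M+2Y)(Q₀/(Q²R))(4C_bQ(log 4Q)^{k_b})² · 2‖β‖² · (8C₁(32C₂)^{1/2})^{1/2} N Λ / z^{1/4}`,
`Λ = (1 + log 4N)^{k₁+k₂}`, i.e. `≪ x R⁻¹ Q₀ ‖β‖² ℒ^c z^{−1/4}`.
[cite: BombieriFriedlanderIwaniecActa1986, §7 (7.1) p. 222] -/
theorem e5_le {M Y : ℝ} (hY : 0 < Y) (hYM : Y ≤ M) (a : ℤ) {N Q R Q₀ z : ℝ} (hN : 1 / 2 ≤ N)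
    (hQ : 1 / 2 ≤ Q) (hR : 0 < R) (hQ₀ : 0 < Q₀) (hz : 1 ≤ z) {β γ : ℕ → ℝ} {b : ℕ}
    (hγ : ∀ q, |γ q| ≤ (σ 0 q : ℝ) ^ b) (hsift : IsSifted (dyadic N) z β)
    {Cb C₁ C₂ : ℝ} {kb k₁ k₂ : ℕ} (hb : MomentHyp b Cb kb) (h₁ : MomentHyp 1 C₁ k₁)
    (h₂ : MomentHyp 2 C₂ k₂) (hC₁ : 0 ≤ C₁) (hC₂ : 0 ≤ C₂) :
    ‖alphaHat M Y‖ * |calX a N Q R Q₀ β γ - calX a N Q R Q₀ (sqfPart β) γ| ≤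
      (M + 2 * Y) * (Q₀ / (Q ^ 2 * R) * (4 * Cb * Q * Real.log (4 * Q) ^ kb) ^ 2 *
        (2 * l2Sq N β * (Real.sqrt (8 * C₁ * Real.sqrt (32 * C₂)) * N *
          (1 + Real.log (4 * N)) ^ (k₁ + k₂) / Real.sqrt (Real.sqrt z)))) := by
  have hM : 0 ≤ M := hY.le.trans hYM
  have hN0 : 0 ≤ N := by linarith
  have hQ0 : 0 < Q := by linarith
  set Λ : ℝ := (1 + Real.log (4 * N)) ^ (k₁ + k₂) with hΛ
  have hL1 : 1 ≤ 1 + Real.log (4 * N) := by have := Real.log_nonneg (show (1:ℝ) ≤ 4 * N by linarith); linarith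
  have hΛ1 : 1 ≤ Λ := one_le_pow₀ hL1
  -- the three inputs
  set T₁ : ℝ := 8 * C₁ * N * Λ with hT₁
  set T₂ : ℝ := 8 * C₂ * N * Λ with hT₂
  have hT₁b : ∀ n₁ ∈ dyadic N, ∑ n₂ ∈ dyadic N, tauDiff n₁ n₂ ≤ T₁ := by
    intro n₁ hn₁
    have := sum_tauDiff_pow_le hN hn₁ one_ne_zero h₁ hC₁
    simp only [pow_one] at this
    refine this.trans ?_
    rw [hT₁]; gcongr
    exact pow_le_pow_right₀ hL1 (Nat.le_add_right _ _)
  have hT₂b : ∀ n₁ ∈ dyadic N, ∑ n₂ ∈ dyadic N, tauDiff n₁ n₂ ^ 2 ≤ T₂ := by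
    intro n₁ hn₁
    refine (sum_tauDiff_pow_le hN hn₁ two_ne_zero h₂ hC₂).trans ?_
    rw [hT₂]; gcongr
    exact pow_le_pow_right₀ hL1 (Nat.le_add_left _ _)
  have hNn := card_nsf_support_le hN0 hz hsift
  have hmain := abs_calX_sub_calX_sqfPart_le N hQ0 hR hQ₀ β γ (a := a) (by positivity) (by positivity)
    hT₁b hT₂b hNn
  have hα : ‖alphaHat M Y‖ ≤ M + 2 * Y := norm_fourier_bumpC_le hY hM 0
  have hnum := e5_numerics hN0 hΛ1 hz hC₁ hC₂ (by positivity) le_rfl le_rfl (le_refl (4 * N / z))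
    (T₁ := T₁) (T₂ := T₂)
  have hl2 := l2Sq_nonneg N β
  calc ‖alphaHat M Y‖ * |calX a N Q R Q₀ β γ - calX a N Q R Q₀ (sqfPart β) γ|
      ≤ (M + 2 * Y) * (Q₀ / (Q ^ 2 * R) * (∑ q ∈ dyadic Q, |γ q|) ^ 2 *
          (2 * l2Sq N β * Real.sqrt (T₁ * Real.sqrt (4 * N / z * T₂)))) :=
        mul_le_mul hα hmain (abs_nonneg _) (by positivity)
    _ ≤ _ := by
        refine mul_le_mul_of_nonneg_left ?_ (by positivity)
        have hγ2 := sum_abs_gamma_sq_le hγ hb hQ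
        have hs0 : 0 ≤ Real.sqrt (T₁ * Real.sqrt (4 * N / z * T₂)) := Real.sqrt_nonneg _
        refine mul_le_mul (mul_le_mul_of_nonneg_left hγ2 (by positivity)) ?_ (by positivity) (by positivity)
        exact mul_le_mul_of_nonneg_left hnum (by positivity)


/-! ## E2: `𝒮₁ᶜ(β) − 𝒮₁ᶜ(β♭)` -/

/-- `τ(n)^{B} ≤ τ(n)^{⌈B⌉}` as a real power (`τ(n) ≥ 1`, `n ≥ 1`, `B ≥ 0`). [folklore] -/
theorem rpow_sigma_le_pow_ceil {n : ℕ} (hn : n ≠ 0) (B : ℝ) :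
    (σ 0 n : ℝ) ^ B ≤ (σ 0 n : ℝ) ^ (⌈B⌉₊) := by
  have h1 : (1 : ℝ) ≤ (σ 0 n : ℝ) := by exact_mod_cast one_le_sigma_zero hn
  calc (σ 0 n : ℝ) ^ B ≤ (σ 0 n : ℝ) ^ ((⌈B⌉₊ : ℕ) : ℝ) :=
        Real.rpow_le_rpow_of_exponent_le h1 (Nat.le_ceil B)
    _ = _ := Real.rpow_natCast _ _

/-- The shifted products of `BFI.abs_dS1c_sub_sqfPart_le`, squared or not, against plain moments:
for `n₁ ∼ N`, `n₂ ∼ N`, `n₂ ≠ n₁`, `B₃ ≥ 0`, `b₃ = ⌈B₃⌉`,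
`τ(n₂)^{B₃} τ(|n₁−n₂|)^{B₃+1} ≤ (τ(n₂)^{2b₃} + τ(|n₁−n₂|)^{2b₃+2})/2` and the same with all exponents
doubled for the square. [folklore] -/
theorem shifted_prod_le {N : ℝ} (hN : 0 ≤ N) {n₁ n₂ : ℕ} (hn₂ : n₂ ∈ dyadic N) (hne : n₂ ≠ n₁)
    (B₃ : ℝ) :
    (σ 0 n₂ : ℝ) ^ B₃ * tauDiff n₁ n₂ ^ (B₃ + 1) ≤
        ((σ 0 n₂ : ℝ) ^ (2 * ⌈B₃⌉₊) + tauDiff n₁ n₂ ^ (2 * ⌈B₃⌉₊ + 2)) / 2 ∧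
      ((σ 0 n₂ : ℝ) ^ B₃ * tauDiff n₁ n₂ ^ (B₃ + 1)) ^ 2 ≤
        ((σ 0 n₂ : ℝ) ^ (4 * ⌈B₃⌉₊) + tauDiff n₁ n₂ ^ (4 * ⌈B₃⌉₊ + 4)) / 2 := by
  set b₃ := ⌈B₃⌉₊ with hb₃
  have hn₂0 : n₂ ≠ 0 := (pos_of_mem_dyadic hN hn₂).ne'
  have hd0 : Int.natAbs ((n₁ : ℤ) - n₂) ≠ 0 := by rw [Int.natAbs_ne_zero]; omega
  have hx : (σ 0 n₂ : ℝ) ^ B₃ ≤ (σ 0 n₂ : ℝ) ^ b₃ := rpow_sigma_le_pow_ceil hn₂0 B₃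
  have hy : tauDiff n₁ n₂ ^ (B₃ + 1) ≤ tauDiff n₁ n₂ ^ (b₃ + 1) := by
    unfold tauDiff
    have h1 : (1 : ℝ) ≤ (σ 0 (Int.natAbs ((n₁ : ℤ) - n₂)) : ℝ) := by exact_mod_cast one_le_sigma_zero hd0
    calc (σ 0 (Int.natAbs ((n₁ : ℤ) - n₂)) : ℝ) ^ (B₃ + 1)
        ≤ (σ 0 (Int.natAbs ((n₁ : ℤ) - n₂)) : ℝ) ^ (((b₃ + 1 : ℕ)) : ℝ) := by
          refine Real.rpow_le_rpow_of_exponent_le h1 ?_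
          push_cast; linarith [Nat.le_ceil B₃]
      _ = _ := Real.rpow_natCast _ _
  have hx0 : 0 ≤ (σ 0 n₂ : ℝ) ^ B₃ := by positivity
  have hy0 : 0 ≤ tauDiff n₁ n₂ ^ (B₃ + 1) := by have := tauDiff_nonneg n₁ n₂; positivity
  have hprod : (σ 0 n₂ : ℝ) ^ B₃ * tauDiff n₁ n₂ ^ (B₃ + 1) ≤ (σ 0 n₂ : ℝ) ^ b₃ * tauDiff n₁ n₂ ^ (b₃ + 1) :=
    mul_le_mul hx hy hy0 (by positivity)
  set X := (σ 0 n₂ : ℝ) ^ b₃ with hX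
  set Yv := tauDiff n₁ n₂ ^ (b₃ + 1) with hYv
  have hXY : X * Yv ≤ (X ^ 2 + Yv ^ 2) / 2 := by nlinarith [sq_nonneg (X - Yv)]
  have e1 : X ^ 2 = (σ 0 n₂ : ℝ) ^ (2 * b₃) := by rw [hX, ← pow_mul, mul_comm]
  have e2 : Yv ^ 2 = tauDiff n₁ n₂ ^ (2 * b₃ + 2) := by rw [hYv, ← pow_mul]; ring_nf
  have hp0 : 0 ≤ (σ 0 n₂ : ℝ) ^ B₃ * tauDiff n₁ n₂ ^ (B₃ + 1) := mul_nonneg hx0 hy0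
  constructor
  · rw [← e1, ← e2]; exact hprod.trans hXY
  · have hsq : ((σ 0 n₂ : ℝ) ^ B₃ * tauDiff n₁ n₂ ^ (B₃ + 1)) ^ 2 ≤ (X * Yv) ^ 2 :=
      pow_le_pow_left₀ hp0 hprod 2
    have hXY2 : (X * Yv) ^ 2 ≤ (X ^ 4 + Yv ^ 4) / 2 := by nlinarith [sq_nonneg (X ^ 2 - Yv ^ 2)]
    have e3 : X ^ 4 = (σ 0 n₂ : ℝ) ^ (4 * b₃) := by rw [hX, ← pow_mul, mul_comm]
    have e4 : Yv ^ 4 = tauDiff n₁ n₂ ^ (4 * b₃ + 4) := by rw [hYv, ← pow_mul]; ring_nf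
    rw [← e3, ← e4]; exact hsq.trans hXY2

/-- `U₂` of `BFI.abs_dS1c_sub_sqfPart_le` against moments: for `n₁ ∼ N` (`N ≥ 1/2`), `B₃ ≥ 0`,
`b₃ = ⌈B₃⌉`, `∑_{n₂∼N, n₂≠n₁} τ(n₂)^{B₃}τ(|n₁−n₂|)^{B₃+1} ≤ 6 (C + C') N (1 + log 4N)^{k + k'}`
under the moments for `τ^{2b₃}` and `τ^{2b₃+2}`. [folklore] -/
theorem u2_le {N : ℝ} (hN : 1 / 2 ≤ N) {n₁ : ℕ} (hn₁ : n₁ ∈ dyadic N) (B₃ : ℝ)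
    {C C' : ℝ} {k k' : ℕ} (h : MomentHyp (2 * ⌈B₃⌉₊) C k) (h' : MomentHyp (2 * ⌈B₃⌉₊ + 2) C' k')
    (hC : 0 ≤ C) (hC' : 0 ≤ C') :
    ∑ n₂ ∈ (dyadic N).filter (fun n₂ => n₂ ≠ n₁), (σ 0 n₂ : ℝ) ^ B₃ * tauDiff n₁ n₂ ^ (B₃ + 1) ≤
      6 * (C + C') * N * (1 + Real.log (4 * N)) ^ (k + k') := by
  have hN0 : 0 ≤ N := by linarith
  have hL1 : 1 ≤ 1 + Real.log (4 * N) := by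
    have := Real.log_nonneg (show (1:ℝ) ≤ 4 * N by linarith); linarith
  calc ∑ n₂ ∈ (dyadic N).filter (fun n₂ => n₂ ≠ n₁), (σ 0 n₂ : ℝ) ^ B₃ * tauDiff n₁ n₂ ^ (B₃ + 1)
      ≤ ∑ n₂ ∈ (dyadic N).filter (fun n₂ => n₂ ≠ n₁),
          ((σ 0 n₂ : ℝ) ^ (2 * ⌈B₃⌉₊) + tauDiff n₁ n₂ ^ (2 * ⌈B₃⌉₊ + 2)) / 2 := by
        refine Finset.sum_le_sum fun n₂ hn₂ => ?_
        rw [Finset.mem_filter] at hn₂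
        exact (shifted_prod_le hN0 hn₂.1 hn₂.2 B₃).1
    _ ≤ ∑ n₂ ∈ dyadic N, ((σ 0 n₂ : ℝ) ^ (2 * ⌈B₃⌉₊) + tauDiff n₁ n₂ ^ (2 * ⌈B₃⌉₊ + 2)) / 2 :=
        Finset.sum_le_sum_of_subset_of_nonneg (Finset.filter_subset _ _) fun n₂ _ _ => by
          have := tauDiff_nonneg n₁ n₂; positivity
    _ = ((∑ n₂ ∈ dyadic N, (σ 0 n₂ : ℝ) ^ (2 * ⌈B₃⌉₊)) +
          ∑ n₂ ∈ dyadic N, tauDiff n₁ n₂ ^ (2 * ⌈B₃⌉₊ + 2)) / 2 := by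
        rw [← Finset.sum_add_distrib, Finset.sum_div]
    _ ≤ ((4 * C * N * Real.log (4 * N) ^ k) + 8 * C' * N * (1 + Real.log (4 * N)) ^ k') / 2 := by
        gcongr
        · exact h.sum_dyadic_le hN
        · exact sum_tauDiff_pow_le hN hn₁ (by omega) h' hC'
    _ ≤ ((4 * C * N * (1 + Real.log (4 * N)) ^ (k + k')) +
          8 * C' * N * (1 + Real.log (4 * N)) ^ (k + k')) / 2 := by
        have hlog0 : 0 ≤ Real.log (4 * N) := Real.log_nonneg (by linarith)
        have i1 : Real.log (4 * N) ^ k ≤ (1 + Real.log (4 * N)) ^ (k + k') :=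
          calc Real.log (4 * N) ^ k ≤ (1 + Real.log (4 * N)) ^ k :=
                pow_le_pow_left₀ hlog0 (by linarith) k
            _ ≤ _ := pow_le_pow_right₀ hL1 (Nat.le_add_right _ _)
        have i2 : (1 + Real.log (4 * N)) ^ k' ≤ (1 + Real.log (4 * N)) ^ (k + k') :=
          pow_le_pow_right₀ hL1 (Nat.le_add_left _ _)
        refine div_le_div_of_nonneg_right (add_le_add ?_ ?_) (by norm_num)
        · exact mul_le_mul_of_nonneg_left i1 (by positivity)
        · exact mul_le_mul_of_nonneg_left i2 (by positivity)
    _ ≤ _ := by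
        have : 0 ≤ N * (1 + Real.log (4 * N)) ^ (k + k') := by positivity
        nlinarith

/-- `U₁` (the exceptional set): with `#Bad ≤ 4N/z`,
`∑_{n₂ ∈ Bad, n₂≠n₁} τ(n₂)^{B₃}τ(|n₁−n₂|)^{B₃+1} ≤ (4N/z)^{1/2} (6(C+C')N(1+log 4N)^{k+k'})^{1/2}` under the
moments for `τ^{4b₃}`, `τ^{4b₃+4}` (Cauchy's inequality). [folklore] -/
theorem u1_le {N z : ℝ} (hN : 1 / 2 ≤ N) (hz : 1 ≤ z) {β : ℕ → ℝ} (hsift : IsSifted (dyadic N) z β)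
    {n₁ : ℕ} (hn₁ : n₁ ∈ dyadic N) (B₃ : ℝ)
    {C C' : ℝ} {k k' : ℕ} (h : MomentHyp (4 * ⌈B₃⌉₊) C k) (h' : MomentHyp (4 * ⌈B₃⌉₊ + 4) C' k')
    (hC : 0 ≤ C) (hC' : 0 ≤ C') :
    ∑ n₂ ∈ (badSet N β).filter (fun n₂ => n₂ ≠ n₁), (σ 0 n₂ : ℝ) ^ B₃ * tauDiff n₁ n₂ ^ (B₃ + 1) ≤
      Real.sqrt (4 * N / z) * Real.sqrt (6 * (C + C') * N * (1 + Real.log (4 * N)) ^ (k + k')) := by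
  classical
  have hN0 : 0 ≤ N := by linarith
  have hL1 : 1 ≤ 1 + Real.log (4 * N) := by
    have := Real.log_nonneg (show (1:ℝ) ≤ 4 * N by linarith); linarith
  set S := (badSet N β).filter (fun n₂ => n₂ ≠ n₁) with hS
  set f : ℕ → ℝ := fun n₂ => (σ 0 n₂ : ℝ) ^ B₃ * tauDiff n₁ n₂ ^ (B₃ + 1) with hf
  have hcs := Real.sum_mul_le_sqrt_mul_sqrt S (fun _ => (1 : ℝ)) f
  simp only [one_mul, one_pow, Finset.sum_const, nsmul_eq_mul, mul_one] at hcs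
  refine hcs.trans ?_
  have hcard : ((S.card : ℕ) : ℝ) ≤ 4 * N / z := by
    have h1 : S.card ≤ (badSet N β).card := Finset.card_le_card (Finset.filter_subset _ _)
    have h2 := card_nsf_support_le hN0 hz hsift
    unfold badSet at h1
    exact le_trans (by exact_mod_cast h1) h2
  have hsumsq : ∑ n₂ ∈ S, f n₂ ^ 2 ≤ 6 * (C + C') * N * (1 + Real.log (4 * N)) ^ (k + k') := by
    calc ∑ n₂ ∈ S, f n₂ ^ 2
        ≤ ∑ n₂ ∈ (dyadic N).filter (fun n₂ => n₂ ≠ n₁), f n₂ ^ 2 := by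
          refine Finset.sum_le_sum_of_subset_of_nonneg ?_ fun _ _ _ => sq_nonneg _
          intro n₂ hn₂
          rw [hS, Finset.mem_filter] at hn₂
          rw [Finset.mem_filter]
          exact ⟨badSet_subset N β hn₂.1, hn₂.2⟩
      _ ≤ ∑ n₂ ∈ (dyadic N).filter (fun n₂ => n₂ ≠ n₁),
          ((σ 0 n₂ : ℝ) ^ (4 * ⌈B₃⌉₊) + tauDiff n₁ n₂ ^ (4 * ⌈B₃⌉₊ + 4)) / 2 := by
          refine Finset.sum_le_sum fun n₂ hn₂ => ?_
          rw [Finset.mem_filter] at hn₂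
          exact (shifted_prod_le hN0 hn₂.1 hn₂.2 B₃).2
      _ ≤ ∑ n₂ ∈ dyadic N, ((σ 0 n₂ : ℝ) ^ (4 * ⌈B₃⌉₊) + tauDiff n₁ n₂ ^ (4 * ⌈B₃⌉₊ + 4)) / 2 :=
          Finset.sum_le_sum_of_subset_of_nonneg (Finset.filter_subset _ _) fun n₂ _ _ => by
            have := tauDiff_nonneg n₁ n₂; positivity
      _ = ((∑ n₂ ∈ dyadic N, (σ 0 n₂ : ℝ) ^ (4 * ⌈B₃⌉₊)) +
            ∑ n₂ ∈ dyadic N, tauDiff n₁ n₂ ^ (4 * ⌈B₃⌉₊ + 4)) / 2 := by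
          rw [← Finset.sum_add_distrib, Finset.sum_div]
      _ ≤ ((4 * C * N * Real.log (4 * N) ^ k) + 8 * C' * N * (1 + Real.log (4 * N)) ^ k') / 2 := by
          gcongr
          · exact h.sum_dyadic_le hN
          · exact sum_tauDiff_pow_le hN hn₁ (by omega) h' hC'
      _ ≤ ((4 * C * N * (1 + Real.log (4 * N)) ^ (k + k')) +
            8 * C' * N * (1 + Real.log (4 * N)) ^ (k + k')) / 2 := by
          have hlog0 : 0 ≤ Real.log (4 * N) := Real.log_nonneg (by linarith)
          have i1 : Real.log (4 * N) ^ k ≤ (1 + Real.log (4 * N)) ^ (k + k') :=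
            calc Real.log (4 * N) ^ k ≤ (1 + Real.log (4 * N)) ^ k :=
                  pow_le_pow_left₀ hlog0 (by linarith) k
              _ ≤ _ := pow_le_pow_right₀ hL1 (Nat.le_add_right _ _)
          have i2 : (1 + Real.log (4 * N)) ^ k' ≤ (1 + Real.log (4 * N)) ^ (k + k') :=
            pow_le_pow_right₀ hL1 (Nat.le_add_left _ _)
          refine div_le_div_of_nonneg_right (add_le_add ?_ ?_) (by norm_num)
          · exact mul_le_mul_of_nonneg_left i1 (by positivity)
          · exact mul_le_mul_of_nonneg_left i2 (by positivity)
      _ ≤ _ := by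
          have : 0 ≤ N * (1 + Real.log (4 * N)) ^ (k + k') := by positivity
          nlinarith
  exact mul_le_mul (Real.sqrt_le_sqrt hcard) (Real.sqrt_le_sqrt hsumsq) (Real.sqrt_nonneg _)
    (Real.sqrt_nonneg _)

/-- `Γ = ∑_{q∼Q} |γ_q| τ(q)^{B₃}/q ≤ 4 C (log 4Q)^k` under `|γ_q| ≤ τ(q)^b` and the moment for
`τ^{b+⌈B₃⌉}`. [folklore] -/
theorem gammaSum_le {γ : ℕ → ℝ} {b : ℕ} (hγ : ∀ q, |γ q| ≤ (σ 0 q : ℝ) ^ b) (B₃ : ℝ)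
    {C : ℝ} {k : ℕ} (h : MomentHyp (b + ⌈B₃⌉₊) C k) {Q : ℝ} (hQ : 1 / 2 ≤ Q) :
    ∑ q ∈ dyadic Q, |γ q| * (σ 0 q : ℝ) ^ B₃ / q ≤ 4 * C * Real.log (4 * Q) ^ k := by
  have hQ0 : 0 ≤ Q := by linarith
  refine le_trans (Finset.sum_le_sum fun q hq => ?_) (h.sum_dyadic_div_le hQ)
  have hq0 : q ≠ 0 := (pos_of_mem_dyadic hQ0 hq).ne'
  have hq0' : (0 : ℝ) < q := by exact_mod_cast pos_of_mem_dyadic hQ0 hq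
  rw [pow_add]
  refine div_le_div_of_nonneg_right (mul_le_mul (hγ q) (rpow_sigma_le_pow_ceil hq0 B₃)
    (by positivity) (by positivity)) hq0'.le

/-- **E2** (BFI (6.8), the non-squarefree pairs of `𝒮₁ᶜ`): under the hypotheses of
`BFI.abs_dS1c_sub_sqfPart_le` with the divisor sums discharged by moments and (A₄) at level `z`,
`|𝒮₁ᶜ(β) − 𝒮₁ᶜ(β♭)| ≤ 2 C₃ (2M+Y) lg^{B₃} (4C_Γ(log 4Q)^{k_Γ}) R⁻¹ ‖β‖² · (4N/z)^{1/4} (6(C+C')N Λ)^{3/4}`-shaped;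
precisely the bound below, `≪ x R⁻¹ ‖β‖² ℒ^c z^{−1/4}`.
[cite: BombieriFriedlanderIwaniecActa1986, §6 (6.8) p. 220] -/
theorem e2_le {a : ℤ} {M Y N Q R Q₀ z : ℝ} (hY : 0 < Y) (hYM : Y ≤ M)
    (haM : (|a| : ℝ) < M - Y) (hN : 1 ≤ N) (hQ : 1 / 2 ≤ Q) (hR : 0 < R) (hz : 1 ≤ z)
    {γ : ℕ → ℝ} {b : ℕ} (hγ : ∀ q, |γ q| ≤ (σ 0 q : ℝ) ^ b) {β : ℕ → ℝ}
    (hsift : IsSifted (dyadic N) z β)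
    {C₃ B₃ X₀ ε₃ lg : ℝ} (hC₃ : 0 ≤ C₃) (hB₃ : 0 ≤ B₃) (hlg0 : 0 ≤ lg)
    (hL3 : ∀ X : ℝ, X₀ ≤ X → ∀ k : ℕ, 0 < k → (k : ℝ) ≤ X ^ (1 - ε₃) → ∀ l : ZMod k,
      ∑ v ∈ l3Set a X k l, l3Term a ((b : ℝ) + 1) v ≤ C₃ * (X / k) * ((σ 0 k : ℝ) * Real.log X) ^ B₃)
    (hX₀ : X₀ ≤ (2 * M + Y) * N)
    (hlev : ∀ q₁ ∈ dyadic Q, ∀ r ∈ dyadic R, ∀ n ∈ dyadic N,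
      ((q₁ * r * n : ℕ) : ℝ) ≤ ((2 * M + Y) * n) ^ (1 - ε₃))
    (hlg : ∀ n ∈ dyadic N, 0 ≤ Real.log ((2 * M + Y) * n) ∧ Real.log ((2 * M + Y) * n) ≤ lg)
    {CΓ Cu Cu' Cv Cv' : ℝ} {kΓ ku ku' kv kv' : ℕ} (hΓ : MomentHyp (b + ⌈B₃⌉₊) CΓ kΓ)
    (hu : MomentHyp (2 * ⌈B₃⌉₊) Cu ku) (hu' : MomentHyp (2 * ⌈B₃⌉₊ + 2) Cu' ku')
    (hv : MomentHyp (4 * ⌈B₃⌉₊) Cv kv) (hv' : MomentHyp (4 * ⌈B₃⌉₊ + 4) Cv' kv')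
    (hCu : 0 < Cu) (hCu' : 0 ≤ Cu') (hCv : 0 < Cv) (hCv' : 0 ≤ Cv') :
    |dS1c a (mRange M Y) N Q R Q₀ (fun m => bump M Y m) β γ -
        dS1c a (mRange M Y) N Q R Q₀ (fun m => bump M Y m) (sqfPart β) γ| ≤
      2 * (C₃ * (2 * M + Y) * lg ^ B₃ * (4 * CΓ * Real.log (4 * Q) ^ kΓ) * R⁻¹ * l2Sq N β) *
        (Real.sqrt (Real.sqrt (4 * N / z) * Real.sqrt (6 * (Cv + Cv') * N * (1 + Real.log (4 * N)) ^ (kv + kv'))) *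
          Real.sqrt (6 * (Cu + Cu') * N * (1 + Real.log (4 * N)) ^ (ku + ku'))) := by
  have hN2 : 1 / 2 ≤ N := by linarith
  have hN0 : 0 < N := by linarith
  have hQ0 : 0 < Q := by linarith
  have hz0 : 0 < z := by linarith
  have hL1 : 1 ≤ 1 + Real.log (4 * N) := by
    have := Real.log_nonneg (show (1:ℝ) ≤ 4 * N by linarith); linarith
  have hγ' : ∀ q, |γ q| ≤ (σ 0 q : ℝ) ^ (b : ℝ) := fun q => by rw [Real.rpow_natCast]; exact hγ q
  set U₁ : ℝ := Real.sqrt (4 * N / z) * Real.sqrt (6 * (Cv + Cv') * N * (1 + Real.log (4 * N)) ^ (kv + kv'))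
    with hU₁
  set U₂ : ℝ := 6 * (Cu + Cu') * N * (1 + Real.log (4 * N)) ^ (ku + ku') with hU₂
  have hU₁pos : 0 < U₁ := by
    rw [hU₁]; refine mul_pos (Real.sqrt_pos.2 (by positivity)) (Real.sqrt_pos.2 ?_)
    have : 0 < Cv + Cv' := by linarith
    positivity
  have hU₂pos : 0 < U₂ := by
    have : 0 < Cu + Cu' := by linarith
    rw [hU₂]; positivity
  have hU₁b : ∀ n₁ ∈ dyadic N, ∑ n₂ ∈ (badSet N β).filter (fun n₂ => n₂ ≠ n₁),
      (σ 0 n₂ : ℝ) ^ B₃ * tauDiff n₁ n₂ ^ (B₃ + 1) ≤ U₁ := fun n₁ hn₁ =>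
    u1_le hN2 hz hsift hn₁ B₃ hv hv' hCv.le hCv'
  have hU₂b : ∀ n₁ ∈ dyadic N, ∑ n₂ ∈ (dyadic N).filter (fun n₂ => n₂ ≠ n₁),
      (σ 0 n₂ : ℝ) ^ B₃ * tauDiff n₁ n₂ ^ (B₃ + 1) ≤ U₂ := fun n₁ hn₁ =>
    u2_le hN2 hn₁ B₃ hu hu' hCu.le hCu'
  have hmain := abs_dS1c_sub_sqfPart_le hY hYM haM hN hQ0 hR (Nat.cast_nonneg b) hγ' β hC₃ hB₃ hlg0
    hU₁pos hU₂pos hL3 hX₀ hlev hlg hU₁b hU₂b (Q₀ := Q₀)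
  refine hmain.trans ?_
  have hΓb := gammaSum_le hγ B₃ hΓ hQ
  have hΓ0 : 0 ≤ ∑ q ∈ dyadic Q, |γ q| * (σ 0 q : ℝ) ^ B₃ / q :=
    Finset.sum_nonneg fun q _ => by positivity
  have hl2 := l2Sq_nonneg N β
  have hM : 0 ≤ M := hY.le.trans hYM
  have hK0 : 0 ≤ C₃ * (2 * M + Y) * lg ^ B₃ := by
    have : 0 ≤ lg ^ B₃ := Real.rpow_nonneg hlg0 _
    positivity
  gcongr


/-! ## E6: `α̂₀ (𝒳 − X)` -/

/-- `Nat.log 2 n ≤ 2 log n` (real), for all `n` (`log 2 ≥ 1/2`). [folklore] -/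
theorem natLog_two_le (n : ℕ) : (Nat.log 2 n : ℝ) ≤ 2 * Real.log n := by
  rcases Nat.eq_zero_or_pos n with rfl | hn
  · simp
  have h1 : (2 : ℝ) ^ (Nat.log 2 n) ≤ n := by exact_mod_cast Nat.pow_log_le_self 2 hn.ne'
  have h2 : (Nat.log 2 n : ℝ) * Real.log 2 ≤ Real.log n := by
    rw [← Real.log_pow]; exact Real.log_le_log (by positivity) h1
  have hlog2 : (1 : ℝ) / 2 ≤ Real.log 2 := by
    have := Real.log_two_gt_d9; linarith
  have h0 : 0 ≤ (Nat.log 2 n : ℝ) := Nat.cast_nonneg _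
  nlinarith

/-- Divisor sums over the multiples of `g` in a dyadic range: for `Q ≥ 1/2`, `g ≥ 1`,
`∑_{q∼Q, g∣q} τ(q)^b/q ≤ (τ(g)^b/g) · 4C (1 + log 4Q)^k`. [folklore] -/
theorem sum_dyadic_dvd_div_le {b : ℕ} {C : ℝ} {k : ℕ} (h : MomentHyp b C k) (hC : 0 ≤ C) {Q : ℝ}
    (hQ : 1 / 2 ≤ Q) {g : ℕ} (hg : 0 < g) :
    ∑ q ∈ (dyadic Q).filter (fun q => g ∣ q), (σ 0 q : ℝ) ^ b / q ≤
      ((σ 0 g : ℝ) ^ b / g) * (4 * C * (1 + Real.log (4 * Q)) ^ k) := by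
  have hQ0 : 0 < Q := by linarith
  have hg0 : (0 : ℝ) < g := by exact_mod_cast hg
  have hlog4Q : 0 ≤ Real.log (4 * Q) := Real.log_nonneg (by linarith)
  -- reindex `q = g q'`, `q' ∼ Q/g`
  have hinj : Set.InjOn (fun q' : ℕ => g * q') (dyadic (Q / g) : Set ℕ) := fun a _ b _ hab =>
    Nat.eq_of_mul_eq_mul_left hg hab
  have himg : (dyadic Q).filter (fun q => g ∣ q) ⊆ (dyadic (Q / g)).image (fun q' => g * q') := by
    intro q hq
    rw [Finset.mem_filter] at hq
    obtain ⟨hqQ, q', rfl⟩ := hq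
    have hb := (mem_dyadic hQ0.le).1 hqQ
    rw [Finset.mem_image]
    refine ⟨q', ?_, rfl⟩
    rw [mem_dyadic (by positivity)]
    push_cast at hb
    constructor
    · rw [div_lt_iff₀ hg0]; linarith
    · rw [show 2 * (Q / (g : ℝ)) = 2 * Q / g by ring, le_div_iff₀ hg0]; linarith
  calc ∑ q ∈ (dyadic Q).filter (fun q => g ∣ q), (σ 0 q : ℝ) ^ b / q
      ≤ ∑ q ∈ (dyadic (Q / g)).image (fun q' => g * q'), (σ 0 q : ℝ) ^ b / q :=
        Finset.sum_le_sum_of_subset_of_nonneg himg fun _ _ _ => by positivity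
    _ = ∑ q' ∈ dyadic (Q / g), (σ 0 (g * q') : ℝ) ^ b / ((g * q' : ℕ) : ℝ) := Finset.sum_image hinj
    _ ≤ ∑ q' ∈ dyadic (Q / g), ((σ 0 g : ℝ) ^ b / g) * ((σ 0 q' : ℝ) ^ b / q') := by
        refine Finset.sum_le_sum fun q' hq' => ?_
        have hq'0 : (0 : ℝ) < q' := by exact_mod_cast pos_of_mem_dyadic (by positivity) hq'
        have hτ : (σ 0 (g * q') : ℝ) ^ b ≤ ((σ 0 g : ℝ) * (σ 0 q' : ℝ)) ^ b :=
          pow_le_pow_left₀ (by positivity) (by exact_mod_cast sigma_zero_mul_le g q') b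
        rw [mul_pow] at hτ
        push_cast
        rw [show (σ 0 g : ℝ) ^ b / g * ((σ 0 q' : ℝ) ^ b / q') = (σ 0 g : ℝ) ^ b * (σ 0 q' : ℝ) ^ b / (g * q') by
          field_simp]
        exact div_le_div_of_nonneg_right hτ (by positivity)
    _ = ((σ 0 g : ℝ) ^ b / g) * ∑ q' ∈ dyadic (Q / g), (σ 0 q' : ℝ) ^ b / q' := by rw [Finset.mul_sum]
    _ ≤ ((σ 0 g : ℝ) ^ b / g) * (4 * C * (1 + Real.log (4 * Q)) ^ k) := by
        refine mul_le_mul_of_nonneg_left ?_ (by positivity)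
        by_cases hQg : 1 / 2 ≤ Q / g
        · refine (h.sum_dyadic_div_le hQg).trans ?_
          have h1 : Real.log (4 * (Q / g)) ≤ 1 + Real.log (4 * Q) := by
            have : Real.log (4 * (Q / g)) ≤ Real.log (4 * Q) := by
              refine Real.log_le_log (by positivity) ?_
              rw [mul_div_assoc']; exact div_le_self (by positivity) (by exact_mod_cast hg)
            linarith
          have h0 : 0 ≤ Real.log (4 * (Q / g)) := Real.log_nonneg (by linarith)
          gcongr
        · have hempty : dyadic (Q / g) = ∅ := by
            rw [Finset.eq_empty_iff_forall_notMem]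
            intro q' hq'
            have hb := (mem_dyadic (by positivity)).1 hq'
            have h1 : (1 : ℝ) ≤ q' := by exact_mod_cast pos_of_mem_dyadic (by positivity) hq'
            rw [not_le] at hQg
            have h2 : (q' : ℝ) ≤ 2 * (Q / g) := hb.2
            linarith
          rw [hempty, Finset.sum_empty]; positivity

/-- **E6 (c)**: the `X`-terms with `(q₁,q₂) > Q₀` (BFI (7.5)): for `Q, R ≥ 1/2`, `1 ≤ Q₀`,
`|γ_q| ≤ τ(q)^b`,
`∑_{r,q₁,q₂: (q₁,q₂)>Q₀} |γγ|(∑|β|)²/(Lφ(q₀r)) ≤ (2N+1)‖β‖² (4C₁(log 4R)^{k₁}/R)(4C(1+log 4Q)^k)² (8C'(log 8Q)^{k'})/Q₀`.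
[cite: BombieriFriedlanderIwaniecActa1986, §7 (7.5) p. 223] -/
theorem e6c_le {N Q R Q₀ : ℝ} (hN : 0 ≤ N) (hQ : 1 / 2 ≤ Q) (hR : 1 / 2 ≤ R) (hQ₀ : 1 ≤ Q₀)
    (β : ℕ → ℝ) {γ : ℕ → ℝ} {b : ℕ} (hγ : ∀ q, |γ q| ≤ (σ 0 q : ℝ) ^ b)
    {C₁ C C' : ℝ} {k₁ k k' : ℕ} (h₁ : MomentHyp 1 C₁ k₁) (h : MomentHyp b C k)
    (h' : MomentHyp (2 * b + 1) C' k') (hC₁ : 0 ≤ C₁) (hC : 0 ≤ C) (hC' : 0 ≤ C') :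
    ∑ r ∈ dyadic R, ∑ q₁ ∈ dyadic Q, ∑ q₂ ∈ dyadic Q,
      (if (Nat.gcd q₁ q₂ : ℝ) ≤ Q₀ then 0 else
        |γ q₁| * |γ q₂| * (∑ n ∈ dyadic N, |β n|) ^ 2 /
          ((lmod r q₁ q₂ : ℝ) * (Nat.totient (gmod r q₁ q₂) : ℝ))) ≤
      ((2 * N + 1) * l2Sq N β) * (4 * C₁ * Real.log (4 * R) ^ k₁ / R) *
        ((4 * C * (1 + Real.log (4 * Q)) ^ k) ^ 2 * (8 * C' * Real.log (4 * (2 * Q)) ^ k' / Q₀)) := by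
  classical
  have hQ0 : 0 < Q := by linarith
  have hR0 : 0 < R := by linarith
  have hlog4Q : 0 ≤ Real.log (4 * Q) := Real.log_nonneg (by linarith)
  have hlog4R : 0 ≤ Real.log (4 * R) := Real.log_nonneg (by linarith)
  have hlog8Q : 0 ≤ Real.log (4 * (2 * Q)) := Real.log_nonneg (by linarith)
  set Sβ := (∑ n ∈ dyadic N, |β n|) ^ 2 with hSβ
  have hSβ0 : 0 ≤ Sβ := sq_nonneg _
  have hβ : Sβ ≤ (2 * N + 1) * l2Sq N β := by
    have hh := sum_abs_le_sqrt_l2Sq hN β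
    have h0 : 0 ≤ ∑ n ∈ dyadic N, |β n| := Finset.sum_nonneg fun _ _ => abs_nonneg _
    calc Sβ ≤ (Real.sqrt (l2Sq N β) * Real.sqrt (2 * N + 1)) ^ 2 := pow_le_pow_left₀ h0 hh 2
      _ = (2 * N + 1) * l2Sq N β := by
          rw [mul_pow, Real.sq_sqrt (l2Sq_nonneg N β), Real.sq_sqrt (by linarith)]; ring
  set ΛQ : ℝ := 4 * C * (1 + Real.log (4 * Q)) ^ k with hΛQ
  have hΛQ0 : 0 ≤ ΛQ := by positivity
  set ΛR : ℝ := 4 * C₁ * Real.log (4 * R) ^ k₁ with hΛR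
  -- Step 1: the `r`-sum for fixed `q₁, q₂` with `g = gcd > Q₀`
  have hstep1 : ∀ q₁ ∈ dyadic Q, ∀ q₂ ∈ dyadic Q, ¬((Nat.gcd q₁ q₂ : ℝ) ≤ Q₀) →
      ∑ r ∈ dyadic R, |γ q₁| * |γ q₂| * Sβ / ((lmod r q₁ q₂ : ℝ) * (Nat.totient (gmod r q₁ q₂) : ℝ)) ≤
        Sβ * (ΛR / R) * ((σ 0 q₁ : ℝ) ^ b / q₁ * ((σ 0 q₂ : ℝ) ^ b / q₂) * (σ 0 (Nat.gcd q₁ q₂) : ℝ)) := by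
    intro q₁ hq₁ q₂ hq₂ _
    have hq₁0 := pos_of_mem_dyadic hQ0.le hq₁
    have hq₂0 := pos_of_mem_dyadic hQ0.le hq₂
    set g := Nat.gcd q₁ q₂ with hg
    have hg0 : 0 < g := Nat.gcd_pos_of_pos_left _ hq₁0
    have hq₁r : (0 : ℝ) < q₁ := by exact_mod_cast hq₁0
    have hq₂r : (0 : ℝ) < q₂ := by exact_mod_cast hq₂0
    have hgr : (0 : ℝ) < g := by exact_mod_cast hg0
    -- termwise: `1/(L φ(g r)) ≤ (g/(q₁ q₂ R)) τ(g) τ(r)/(g r) = τ(g) τ(r) / (q₁ q₂ R r)`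
    have hterm : ∀ r ∈ dyadic R,
        |γ q₁| * |γ q₂| * Sβ / ((lmod r q₁ q₂ : ℝ) * (Nat.totient (gmod r q₁ q₂) : ℝ)) ≤
          Sβ * (R⁻¹ * ((σ 0 r : ℝ) / r)) *
            ((σ 0 q₁ : ℝ) ^ b / q₁ * ((σ 0 q₂ : ℝ) ^ b / q₂) * (σ 0 g : ℝ)) := by
      intro r hr
      have hr0 := pos_of_mem_dyadic hR0.le hr
      have hrb := ((mem_dyadic hR0.le).1 hr).1
      have hrr : (0 : ℝ) < r := by exact_mod_cast hr0
      have hL : (lmod r q₁ q₂ : ℝ) * g = (q₁ : ℝ) * q₂ * r := by exact_mod_cast lmod_mul_gcd r q₁ q₂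
      have hLpos : (0 : ℝ) < lmod r q₁ q₂ := by exact_mod_cast lmod_pos hr0 hq₁0 hq₂0
      have hφ : ((Nat.totient (gmod r q₁ q₂) : ℝ))⁻¹ ≤ (σ 0 g : ℝ) * (σ 0 r : ℝ) / ((g : ℝ) * r) := by
        unfold gmod; rw [← hg]; exact inv_totient_mul_le hg0 hr0
      have hφpos : (0 : ℝ) < (Nat.totient (gmod r q₁ q₂) : ℝ) := by
        exact_mod_cast Nat.totient_pos.2 (gmod_pos hr0 hq₁0)
      have hLinv : ((lmod r q₁ q₂ : ℕ) : ℝ)⁻¹ = g / ((q₁ : ℝ) * q₂ * r) := by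
        rw [eq_div_iff (by positivity), ← hL]; field_simp
      rw [div_eq_mul_inv, mul_inv, hLinv]
      have hγ₁ := hγ q₁; have hγ₂ := hγ q₂
      calc |γ q₁| * |γ q₂| * Sβ * ((g : ℝ) / ((q₁ : ℝ) * q₂ * r) * ((Nat.totient (gmod r q₁ q₂) : ℝ))⁻¹)
          ≤ (σ 0 q₁ : ℝ) ^ b * (σ 0 q₂ : ℝ) ^ b * Sβ *
              ((g : ℝ) / ((q₁ : ℝ) * q₂ * r) * ((σ 0 g : ℝ) * (σ 0 r : ℝ) / ((g : ℝ) * r))) := by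
            refine mul_le_mul (mul_le_mul_of_nonneg_right (mul_le_mul hγ₁ hγ₂ (abs_nonneg _)
              (by positivity)) hSβ0) (mul_le_mul_of_nonneg_left hφ (by positivity))
              (by positivity) (by positivity)
        _ = Sβ * (((r : ℝ))⁻¹ * ((σ 0 r : ℝ) / r)) * ((σ 0 q₁ : ℝ) ^ b / q₁ * ((σ 0 q₂ : ℝ) ^ b / q₂) * (σ 0 g : ℝ)) := by
            field_simp
        _ ≤ Sβ * (R⁻¹ * ((σ 0 r : ℝ) / r)) * ((σ 0 q₁ : ℝ) ^ b / q₁ * ((σ 0 q₂ : ℝ) ^ b / q₂) * (σ 0 g : ℝ)) := by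
            have := inv_anti₀ hR0 hrb.le
            gcongr
    calc _ ≤ ∑ r ∈ dyadic R, Sβ * (R⁻¹ * ((σ 0 r : ℝ) / r)) *
          ((σ 0 q₁ : ℝ) ^ b / q₁ * ((σ 0 q₂ : ℝ) ^ b / q₂) * (σ 0 g : ℝ)) := Finset.sum_le_sum hterm
      _ = Sβ * (R⁻¹ * ∑ r ∈ dyadic R, (σ 0 r : ℝ) / r) *
          ((σ 0 q₁ : ℝ) ^ b / q₁ * ((σ 0 q₂ : ℝ) ^ b / q₂) * (σ 0 g : ℝ)) := by
          rw [Finset.mul_sum, Finset.mul_sum, Finset.sum_mul]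
      _ ≤ Sβ * (ΛR / R) * ((σ 0 q₁ : ℝ) ^ b / q₁ * ((σ 0 q₂ : ℝ) ^ b / q₂) * (σ 0 g : ℝ)) := by
          have hs := h₁.sum_dyadic_div_le hR
          simp only [pow_one] at hs
          have : R⁻¹ * ∑ r ∈ dyadic R, (σ 0 r : ℝ) / r ≤ ΛR / R := by
            rw [div_eq_mul_inv, mul_comm ΛR]
            exact mul_le_mul_of_nonneg_left hs (by positivity)
          gcongr
  -- Step 2: sum over the pairs with `gcd > Q₀`, through `g ∣ q₁, g ∣ q₂`, `g > Q₀`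
  have hstep2 : ∑ q₁ ∈ dyadic Q, ∑ q₂ ∈ dyadic Q,
      (if (Nat.gcd q₁ q₂ : ℝ) ≤ Q₀ then (0 : ℝ) else
        (σ 0 q₁ : ℝ) ^ b / q₁ * ((σ 0 q₂ : ℝ) ^ b / q₂) * (σ 0 (Nat.gcd q₁ q₂) : ℝ)) ≤
      ΛQ ^ 2 * (8 * C' * Real.log (4 * (2 * Q)) ^ k' / Q₀) := by
    -- dominate by the sum over `g ∈ (Icc 1 ⌊2Q⌋).filter (Q₀ < g)` of the sums over multiples
    have hdom : ∀ q₁ ∈ dyadic Q, ∀ q₂ ∈ dyadic Q,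
        (if (Nat.gcd q₁ q₂ : ℝ) ≤ Q₀ then (0 : ℝ) else
          (σ 0 q₁ : ℝ) ^ b / q₁ * ((σ 0 q₂ : ℝ) ^ b / q₂) * (σ 0 (Nat.gcd q₁ q₂) : ℝ)) ≤
        ∑ g ∈ (Icc 1 ⌊2 * Q⌋₊).filter (fun g : ℕ => Q₀ < (g : ℝ)),
          (if g ∣ q₁ ∧ g ∣ q₂ then (σ 0 q₁ : ℝ) ^ b / q₁ * ((σ 0 q₂ : ℝ) ^ b / q₂) * (σ 0 g : ℝ) else 0) := by
      intro q₁ hq₁ q₂ hq₂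
      have hq₁0 := pos_of_mem_dyadic hQ0.le hq₁
      have hnn : ∀ g ∈ (Icc 1 ⌊2 * Q⌋₊).filter (fun g : ℕ => Q₀ < (g : ℝ)),
          (0 : ℝ) ≤ (if g ∣ q₁ ∧ g ∣ q₂ then (σ 0 q₁ : ℝ) ^ b / q₁ * ((σ 0 q₂ : ℝ) ^ b / q₂) * (σ 0 g : ℝ) else 0) :=
        fun g _ => by split_ifs <;> positivity
      split_ifs with hle
      · exact Finset.sum_nonneg hnn
      · have hmem : Nat.gcd q₁ q₂ ∈ (Icc 1 ⌊2 * Q⌋₊).filter (fun g : ℕ => Q₀ < (g : ℝ)) := by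
          rw [Finset.mem_filter, Finset.mem_Icc]
          refine ⟨⟨Nat.gcd_pos_of_pos_left _ hq₁0, ?_⟩, lt_of_not_ge hle⟩
          have h1 : Nat.gcd q₁ q₂ ≤ q₁ := Nat.gcd_le_left _ hq₁0
          have h2 := ((mem_dyadic hQ0.le).1 hq₁).2
          exact Nat.le_floor (le_trans (by exact_mod_cast h1) h2)
        rw [← Finset.sum_erase_add _ _ hmem, if_pos ⟨Nat.gcd_dvd_left _ _, Nat.gcd_dvd_right _ _⟩]
        have : 0 ≤ ∑ g ∈ ((Icc 1 ⌊2 * Q⌋₊).filter (fun g : ℕ => Q₀ < (g : ℝ))).erase (Nat.gcd q₁ q₂),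
            (if g ∣ q₁ ∧ g ∣ q₂ then (σ 0 q₁ : ℝ) ^ b / q₁ * ((σ 0 q₂ : ℝ) ^ b / q₂) * (σ 0 g : ℝ) else 0) :=
          Finset.sum_nonneg fun g hg => hnn g (Finset.mem_of_mem_erase hg)
        linarith
    calc _ ≤ ∑ q₁ ∈ dyadic Q, ∑ q₂ ∈ dyadic Q, ∑ g ∈ (Icc 1 ⌊2 * Q⌋₊).filter (fun g : ℕ => Q₀ < (g : ℝ)),
          (if g ∣ q₁ ∧ g ∣ q₂ then (σ 0 q₁ : ℝ) ^ b / q₁ * ((σ 0 q₂ : ℝ) ^ b / q₂) * (σ 0 g : ℝ) else 0) :=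
          Finset.sum_le_sum fun q₁ hq₁ => Finset.sum_le_sum fun q₂ hq₂ => hdom q₁ hq₁ q₂ hq₂
      _ = ∑ g ∈ (Icc 1 ⌊2 * Q⌋₊).filter (fun g : ℕ => Q₀ < (g : ℝ)),
          (σ 0 g : ℝ) * ((∑ q₁ ∈ (dyadic Q).filter (fun q => g ∣ q), (σ 0 q₁ : ℝ) ^ b / q₁) *
            ∑ q₂ ∈ (dyadic Q).filter (fun q => g ∣ q), (σ 0 q₂ : ℝ) ^ b / q₂) := by
          refine (Finset.sum_congr rfl fun q₁ _ => Finset.sum_comm).trans ?_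
          rw [Finset.sum_comm]
          refine Finset.sum_congr rfl fun g _ => ?_
          rw [Finset.sum_mul_sum, Finset.sum_filter, Finset.mul_sum]
          refine Finset.sum_congr rfl fun q₁ _ => ?_
          rw [Finset.sum_filter]
          by_cases h1 : g ∣ q₁
          · rw [if_pos h1, Finset.mul_sum]
            refine Finset.sum_congr rfl fun q₂ _ => ?_
            by_cases h2 : g ∣ q₂
            · rw [if_pos ⟨h1, h2⟩, if_pos h2]; ring
            · rw [if_neg (fun h => h2 h.2), if_neg h2]; ring
          · rw [if_neg h1, mul_zero]
            exact Finset.sum_eq_zero fun q₂ _ => if_neg (fun h => h1 h.1)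
      _ ≤ ∑ g ∈ (Icc 1 ⌊2 * Q⌋₊).filter (fun g : ℕ => Q₀ < (g : ℝ)),
          (σ 0 g : ℝ) * (((σ 0 g : ℝ) ^ b / g) * ΛQ) ^ 2 := by
          refine Finset.sum_le_sum fun g hg => ?_
          have hg1 : 0 < g := (Finset.mem_Icc.1 (Finset.mem_filter.1 hg).1).1
          have hs := sum_dyadic_dvd_div_le h hC hQ hg1
          have hs0 : 0 ≤ ∑ q ∈ (dyadic Q).filter (fun q => g ∣ q), (σ 0 q : ℝ) ^ b / q :=
            Finset.sum_nonneg fun _ _ => by positivity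
          rw [sq]
          exact mul_le_mul_of_nonneg_left (mul_le_mul hs hs hs0 (by positivity)) (by positivity)
      _ = ΛQ ^ 2 * ∑ g ∈ (Icc 1 ⌊2 * Q⌋₊).filter (fun g : ℕ => Q₀ < (g : ℝ)),
          (σ 0 g : ℝ) ^ (2 * b + 1) / (g : ℝ) ^ 2 := by
          rw [Finset.mul_sum]
          refine Finset.sum_congr rfl fun g hg => ?_
          have hg1 : (0 : ℝ) < g := by exact_mod_cast (Finset.mem_Icc.1 (Finset.mem_filter.1 hg).1).1
          field_simp; ring
      _ ≤ ΛQ ^ 2 * (8 * C' * Real.log (4 * (2 * Q)) ^ k' / Q₀) := by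
          refine mul_le_mul_of_nonneg_left ?_ (by positivity)
          by_cases hQ₀Q : Q₀ ≤ 2 * Q
          · exact h'.sum_tail_div_sq_le hC' hQ₀ hQ₀Q
          · rw [Finset.sum_eq_zero]
            · positivity
            · intro g hg
              exfalso
              rw [Finset.mem_filter, Finset.mem_Icc] at hg
              have h1 : (g : ℝ) ≤ 2 * Q := le_trans (by exact_mod_cast hg.1.2) (Nat.floor_le (by linarith))
              rw [not_le] at hQ₀Q; linarith [hg.2]
  -- assemble
  calc _ = ∑ q₁ ∈ dyadic Q, ∑ q₂ ∈ dyadic Q, ∑ r ∈ dyadic R,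
        (if (Nat.gcd q₁ q₂ : ℝ) ≤ Q₀ then 0 else
          |γ q₁| * |γ q₂| * Sβ / ((lmod r q₁ q₂ : ℝ) * (Nat.totient (gmod r q₁ q₂) : ℝ))) := by
        rw [Finset.sum_comm]; exact Finset.sum_congr rfl fun q₁ _ => Finset.sum_comm
    _ ≤ ∑ q₁ ∈ dyadic Q, ∑ q₂ ∈ dyadic Q,
        (if (Nat.gcd q₁ q₂ : ℝ) ≤ Q₀ then (0 : ℝ) else
          Sβ * (ΛR / R) * ((σ 0 q₁ : ℝ) ^ b / q₁ * ((σ 0 q₂ : ℝ) ^ b / q₂) * (σ 0 (Nat.gcd q₁ q₂) : ℝ))) := by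
        refine Finset.sum_le_sum fun q₁ hq₁ => Finset.sum_le_sum fun q₂ hq₂ => ?_
        by_cases hle : (Nat.gcd q₁ q₂ : ℝ) ≤ Q₀
        · simp only [if_pos hle, Finset.sum_const_zero, le_refl]
        · simp only [if_neg hle]
          exact hstep1 q₁ hq₁ q₂ hq₂ hle
    _ = Sβ * (ΛR / R) * ∑ q₁ ∈ dyadic Q, ∑ q₂ ∈ dyadic Q,
        (if (Nat.gcd q₁ q₂ : ℝ) ≤ Q₀ then (0 : ℝ) else
          (σ 0 q₁ : ℝ) ^ b / q₁ * ((σ 0 q₂ : ℝ) ^ b / q₂) * (σ 0 (Nat.gcd q₁ q₂) : ℝ)) := by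
        rw [Finset.mul_sum]
        refine Finset.sum_congr rfl fun q₁ _ => ?_
        rw [Finset.mul_sum]
        refine Finset.sum_congr rfl fun q₂ _ => ?_
        split_ifs <;> ring
    _ ≤ ((2 * N + 1) * l2Sq N β) * (ΛR / R) * (ΛQ ^ 2 * (8 * C' * Real.log (4 * (2 * Q)) ^ k' / Q₀)) := by
        have hΛR0 : 0 ≤ ΛR / R := by positivity
        have hS0 : 0 ≤ ∑ q₁ ∈ dyadic Q, ∑ q₂ ∈ dyadic Q,
            (if (Nat.gcd q₁ q₂ : ℝ) ≤ Q₀ then (0 : ℝ) else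
              (σ 0 q₁ : ℝ) ^ b / q₁ * ((σ 0 q₂ : ℝ) ^ b / q₂) * (σ 0 (Nat.gcd q₁ q₂) : ℝ)) :=
          Finset.sum_nonneg fun _ _ => Finset.sum_nonneg fun _ _ => by split_ifs <;> positivity
        have hl2 := l2Sq_nonneg N β
        exact mul_le_mul (mul_le_mul_of_nonneg_right hβ hΛR0) hstep2 hS0 (by positivity)


/-- The moduli `q₀ r`, `r ∼ R`, are distinct and `≤ 2Q₀R`: a sum of nonnegative terms over them is
at most the full sum over `q ≤ 2Q₀R`. [folklore] -/
theorem sum_dyadic_mul_le_sum_Icc {R Q₀ : ℝ} (hR : 0 ≤ R) {g : ℕ} (hg : 0 < g) (hgQ₀ : (g : ℝ) ≤ Q₀)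
    (F : ℕ → ℝ) (hF : ∀ q, 0 ≤ F q) :
    ∑ r ∈ dyadic R, F (g * r) ≤ ∑ q ∈ Icc 1 ⌊2 * Q₀ * R⌋₊, F q := by
  have hinj : Set.InjOn (fun r : ℕ => g * r) (dyadic R : Set ℕ) := fun a _ b _ hab =>
    Nat.eq_of_mul_eq_mul_left hg hab
  rw [← Finset.sum_image hinj]
  refine Finset.sum_le_sum_of_subset_of_nonneg ?_ fun q _ _ => hF q
  intro q hq
  rw [Finset.mem_image] at hq
  obtain ⟨r, hr, rfl⟩ := hq
  have hb := (mem_dyadic hR).1 hr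
  have hr1 : 1 ≤ r := pos_of_mem_dyadic hR hr
  rw [Finset.mem_Icc]
  refine ⟨Nat.mul_pos hg hr1, Nat.le_floor ?_⟩
  push_cast
  have hg0 : (0 : ℝ) ≤ g := Nat.cast_nonneg _
  calc (g : ℝ) * r ≤ Q₀ * (2 * R) := mul_le_mul hgQ₀ hb.2 (by positivity) (hg0.trans hgQ₀)
    _ = 2 * Q₀ * R := by ring

/-- **E6 (a)**, per pair `(q₁,q₂)` with `g = (q₁,q₂) ≤ Q₀`: with the BDH input
`∑_{q ≤ 2Q₀R} D(d;q) ≤ Wτ(d)^b`,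
`∑_{r∼R} |γγ|/L · (D(q₁';q₀r) + D(q₂';q₀r))/2 ≤ (WQ₀/R) τ(q₁)^{2b}/q₁ · τ(q₂)^{2b}/q₂`.
[cite: BombieriFriedlanderIwaniecActa1986, §7 (7.2)–(7.4) p. 222] -/
theorem e6a_pair_le {N Q R Q₀ W : ℝ} (hQ : 0 < Q) (hR : 0 < R) (hW : 0 ≤ W) (β : ℕ → ℝ)
    {γ : ℕ → ℝ} {b : ℕ} (hγ : ∀ q, |γ q| ≤ (σ 0 q : ℝ) ^ b)
    (hBDH : ∀ d : ℕ, 1 ≤ d → ∑ q ∈ Icc 1 ⌊2 * Q₀ * R⌋₊, bdhD N β d q ≤ W * (σ 0 d : ℝ) ^ b)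
    {q₁ q₂ : ℕ} (hq₁ : q₁ ∈ dyadic Q) (hq₂ : q₂ ∈ dyadic Q) (hgQ₀ : (Nat.gcd q₁ q₂ : ℝ) ≤ Q₀) :
    ∑ r ∈ dyadic R, |γ q₁| * |γ q₂| / (lmod r q₁ q₂ : ℝ) *
        ((bdhD N β (q₁ / Nat.gcd q₁ q₂) (gmod r q₁ q₂) + bdhD N β (q₂ / Nat.gcd q₁ q₂) (gmod r q₁ q₂)) / 2) ≤
      (W * Q₀ / R) * ((σ 0 q₁ : ℝ) ^ (2 * b) / q₁ * ((σ 0 q₂ : ℝ) ^ (2 * b) / q₂)) := by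
  have hq₁0 := pos_of_mem_dyadic hQ.le hq₁
  have hq₂0 := pos_of_mem_dyadic hQ.le hq₂
  set g := Nat.gcd q₁ q₂ with hg
  have hg0 : 0 < g := Nat.gcd_pos_of_pos_left _ hq₁0
  have hq₁r : (0 : ℝ) < q₁ := by exact_mod_cast hq₁0
  have hq₂r : (0 : ℝ) < q₂ := by exact_mod_cast hq₂0
  have hgr : (0 : ℝ) < g := by exact_mod_cast hg0
  have hQ₀0 : 0 ≤ Q₀ := hgr.le.trans hgQ₀
  have hγγ : |γ q₁| * |γ q₂| ≤ (σ 0 q₁ : ℝ) ^ b * (σ 0 q₂ : ℝ) ^ b :=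
    mul_le_mul (hγ q₁) (hγ q₂) (abs_nonneg _) (by positivity)
  have hγγ0 : 0 ≤ |γ q₁| * |γ q₂| := by positivity
  have hd₁ : 1 ≤ q₁ / g := Nat.div_pos (Nat.gcd_le_left _ hq₁0) hg0
  have hd₂ : 1 ≤ q₂ / g := Nat.div_pos (Nat.gcd_le_right _ hq₂0) hg0
  have hτd₁ : (σ 0 (q₁ / g) : ℝ) ^ b ≤ (σ 0 q₁ : ℝ) ^ b :=
    pow_le_pow_left₀ (Nat.cast_nonneg _)
      (by exact_mod_cast sigma_zero_le_of_dvd hq₁0.ne' (Nat.div_dvd_of_dvd (Nat.gcd_dvd_left _ _))) b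
  have hτd₂ : (σ 0 (q₂ / g) : ℝ) ^ b ≤ (σ 0 q₂ : ℝ) ^ b :=
    pow_le_pow_left₀ (Nat.cast_nonneg _)
      (by exact_mod_cast sigma_zero_le_of_dvd hq₂0.ne' (Nat.div_dvd_of_dvd (Nat.gcd_dvd_right _ _))) b
  have hD₁ := (sum_dyadic_mul_le_sum_Icc hR.le hg0 hgQ₀ (fun q => bdhD N β (q₁ / g) q)
    (fun q => bdhD_nonneg N β _ q)).trans ((hBDH (q₁ / g) hd₁).trans (mul_le_mul_of_nonneg_left hτd₁ hW))
  have hD₂ := (sum_dyadic_mul_le_sum_Icc hR.le hg0 hgQ₀ (fun q => bdhD N β (q₂ / g) q)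
    (fun q => bdhD_nonneg N β _ q)).trans ((hBDH (q₂ / g) hd₂).trans (mul_le_mul_of_nonneg_left hτd₂ hW))
  set D : ℕ → ℝ := fun r => (bdhD N β (q₁ / g) (g * r) + bdhD N β (q₂ / g) (g * r)) / 2 with hD
  have hDnn : ∀ r, 0 ≤ D r := fun r => by
    have := bdhD_nonneg N β (q₁ / g) (g * r); have := bdhD_nonneg N β (q₂ / g) (g * r)
    simp only [hD]; linarith
  have hsumD : ∑ r ∈ dyadic R, D r ≤ (W * (σ 0 q₁ : ℝ) ^ b + W * (σ 0 q₂ : ℝ) ^ b) / 2 := by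
    simp only [hD]
    rw [← Finset.sum_div, Finset.sum_add_distrib]
    linarith
  -- termwise `1/L = g/(q₁q₂r) ≤ g/(q₁q₂R)`
  have hterm : ∀ r ∈ dyadic R, |γ q₁| * |γ q₂| / (lmod r q₁ q₂ : ℝ) *
      ((bdhD N β (q₁ / g) (gmod r q₁ q₂) + bdhD N β (q₂ / g) (gmod r q₁ q₂)) / 2) ≤
      (|γ q₁| * |γ q₂| * (g / ((q₁ : ℝ) * q₂ * R))) * D r := by
    intro r hr
    have hr0 := pos_of_mem_dyadic hR.le hr
    have hrb := ((mem_dyadic hR.le).1 hr).1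
    have hrr : (0 : ℝ) < r := by exact_mod_cast hr0
    have hL : (lmod r q₁ q₂ : ℝ) * g = (q₁ : ℝ) * q₂ * r := by exact_mod_cast lmod_mul_gcd r q₁ q₂
    have hLpos : (0 : ℝ) < lmod r q₁ q₂ := by exact_mod_cast lmod_pos hr0 hq₁0 hq₂0
    have hLinv : ((lmod r q₁ q₂ : ℕ) : ℝ)⁻¹ = g / ((q₁ : ℝ) * q₂ * r) := by
      rw [eq_div_iff (by positivity), ← hL]; field_simp
    have hgmod : gmod r q₁ q₂ = g * r := by unfold gmod; rw [← hg]
    rw [hgmod, div_eq_mul_inv (|γ q₁| * |γ q₂|), hLinv]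
    refine mul_le_mul_of_nonneg_right (mul_le_mul_of_nonneg_left ?_ hγγ0) (hDnn r)
    refine div_le_div_of_nonneg_left hgr.le (by positivity) ?_
    have := mul_le_mul_of_nonneg_left hrb.le (show (0 : ℝ) ≤ (q₁ : ℝ) * q₂ by positivity)
    linarith
  calc _ ≤ ∑ r ∈ dyadic R, (|γ q₁| * |γ q₂| * (g / ((q₁ : ℝ) * q₂ * R))) * D r := Finset.sum_le_sum hterm
    _ = (|γ q₁| * |γ q₂| * (g / ((q₁ : ℝ) * q₂ * R))) * ∑ r ∈ dyadic R, D r := by rw [Finset.mul_sum]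
    _ ≤ ((σ 0 q₁ : ℝ) ^ b * (σ 0 q₂ : ℝ) ^ b * (Q₀ / ((q₁ : ℝ) * q₂ * R))) *
          ((W * (σ 0 q₁ : ℝ) ^ b + W * (σ 0 q₂ : ℝ) ^ b) / 2) := by
        have h1 : |γ q₁| * |γ q₂| * (g / ((q₁ : ℝ) * q₂ * R)) ≤
            (σ 0 q₁ : ℝ) ^ b * (σ 0 q₂ : ℝ) ^ b * (Q₀ / ((q₁ : ℝ) * q₂ * R)) :=
          mul_le_mul hγγ (div_le_div_of_nonneg_right hgQ₀ (by positivity)) (by positivity) (by positivity)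
        exact mul_le_mul h1 hsumD (Finset.sum_nonneg fun r _ => hDnn r) (by positivity)
    _ ≤ (W * Q₀ / R) * ((σ 0 q₁ : ℝ) ^ (2 * b) / q₁ * ((σ 0 q₂ : ℝ) ^ (2 * b) / q₂)) := by
        have h1' : (1 : ℝ) ≤ (σ 0 q₁ : ℝ) := by exact_mod_cast one_le_sigma_zero hq₁0.ne'
        have h2' : (1 : ℝ) ≤ (σ 0 q₂ : ℝ) := by exact_mod_cast one_le_sigma_zero hq₂0.ne'
        have h1 : (1 : ℝ) ≤ (σ 0 q₁ : ℝ) ^ b := one_le_pow₀ h1'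
        have h2 : (1 : ℝ) ≤ (σ 0 q₂ : ℝ) ^ b := one_le_pow₀ h2'
        have h12 : ((σ 0 q₁ : ℝ) ^ b + (σ 0 q₂ : ℝ) ^ b) / 2 ≤ (σ 0 q₁ : ℝ) ^ b * (σ 0 q₂ : ℝ) ^ b := by
          nlinarith
        calc _ = (W * Q₀ / R) * ((σ 0 q₁ : ℝ) ^ b * (σ 0 q₂ : ℝ) ^ b / ((q₁ : ℝ) * q₂)) *
              (((σ 0 q₁ : ℝ) ^ b + (σ 0 q₂ : ℝ) ^ b) / 2) := by field_simp
          _ ≤ (W * Q₀ / R) * ((σ 0 q₁ : ℝ) ^ b * (σ 0 q₂ : ℝ) ^ b / ((q₁ : ℝ) * q₂)) *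
              ((σ 0 q₁ : ℝ) ^ b * (σ 0 q₂ : ℝ) ^ b) := mul_le_mul_of_nonneg_left h12 (by positivity)
          _ = _ := by rw [pow_mul, pow_mul]; field_simp; ring

/-- **E6 (b)**, per pair `(q₁,q₂)` with `g = (q₁,q₂) ≤ Q₀` (the pairs `(n₁,n₂) > 1` of (7.1)):
for `R ≥ 1/2`, `N ≥ 1/2`, `z > 0`,
`∑_{r∼R} |γγ|/L · log₂⌊2N⌋ (2N/(z q₀ r) + 1) ‖β‖² ≤ ‖β‖² 2log(2N) (8N/(zR) + 4Q₀) τ(q₁)^b/q₁ · τ(q₂)^b/q₂`.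
[cite: BombieriFriedlanderIwaniecActa1986, §7 (7.1) p. 222] -/
theorem e6b_pair_le {N Q R Q₀ z : ℝ} (hN : 1 / 2 ≤ N) (hQ : 0 < Q) (hR : 1 / 2 ≤ R) (hz : 0 < z)
    (β : ℕ → ℝ) {γ : ℕ → ℝ} {b : ℕ} (hγ : ∀ q, |γ q| ≤ (σ 0 q : ℝ) ^ b)
    {q₁ q₂ : ℕ} (hq₁ : q₁ ∈ dyadic Q) (hq₂ : q₂ ∈ dyadic Q) (hgQ₀ : (Nat.gcd q₁ q₂ : ℝ) ≤ Q₀) :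
    ∑ r ∈ dyadic R, |γ q₁| * |γ q₂| / (lmod r q₁ q₂ : ℝ) *
        (((Nat.log 2 ⌊2 * N⌋₊ : ℝ) * (2 * N / (z * (gmod r q₁ q₂ : ℝ)) + 1)) * l2Sq N β) ≤
      (l2Sq N β * (2 * Real.log (2 * N)) * (8 * N / (z * R) + 4 * Q₀)) *
        ((σ 0 q₁ : ℝ) ^ b / q₁ * ((σ 0 q₂ : ℝ) ^ b / q₂)) := by
  have hR0 : 0 < R := by linarith
  have hN0 : 0 < N := by linarith
  have hl2 := l2Sq_nonneg N β
  have hq₁0 := pos_of_mem_dyadic hQ.le hq₁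
  have hq₂0 := pos_of_mem_dyadic hQ.le hq₂
  set g := Nat.gcd q₁ q₂ with hg
  have hg0 : 0 < g := Nat.gcd_pos_of_pos_left _ hq₁0
  have hq₁r : (0 : ℝ) < q₁ := by exact_mod_cast hq₁0
  have hq₂r : (0 : ℝ) < q₂ := by exact_mod_cast hq₂0
  have hgr : (0 : ℝ) < g := by exact_mod_cast hg0
  have hQ₀0 : 0 ≤ Q₀ := hgr.le.trans hgQ₀
  have hlog2N : 0 ≤ Real.log (2 * N) := Real.log_nonneg (by linarith)
  have hγγ : |γ q₁| * |γ q₂| ≤ (σ 0 q₁ : ℝ) ^ b * (σ 0 q₂ : ℝ) ^ b :=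
    mul_le_mul (hγ q₁) (hγ q₂) (abs_nonneg _) (by positivity)
  -- `log₂⌊2N⌋ ≤ 2 log(2N)`
  have hlg : (Nat.log 2 ⌊2 * N⌋₊ : ℝ) ≤ 2 * Real.log (2 * N) := by
    refine (natLog_two_le _).trans ?_
    have h1 : (1 : ℝ) ≤ ⌊2 * N⌋₊ := by
      have : 1 ≤ ⌊2 * N⌋₊ := Nat.le_floor (by push_cast; linarith)
      exact_mod_cast this
    have h2 : (⌊2 * N⌋₊ : ℝ) ≤ 2 * N := Nat.floor_le (by linarith)
    have := Real.log_le_log (by linarith) h2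
    linarith
  have hlg0 : 0 ≤ (Nat.log 2 ⌊2 * N⌋₊ : ℝ) := Nat.cast_nonneg _
  set Lg : ℝ := (Nat.log 2 ⌊2 * N⌋₊ : ℝ) with hLg
  -- termwise
  have hterm : ∀ r ∈ dyadic R, |γ q₁| * |γ q₂| / (lmod r q₁ q₂ : ℝ) *
      ((Lg * (2 * N / (z * (gmod r q₁ q₂ : ℝ)) + 1)) * l2Sq N β) ≤
      ((σ 0 q₁ : ℝ) ^ b * (σ 0 q₂ : ℝ) ^ b) * (l2Sq N β * (2 * Real.log (2 * N))) *
        (((2 * N / z) * R⁻¹ + Q₀) * (1 / (r : ℝ))) / ((q₁ : ℝ) * q₂) := by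
    intro r hr
    have hr0 := pos_of_mem_dyadic hR0.le hr
    have hrb := ((mem_dyadic hR0.le).1 hr).1
    have hrr : (0 : ℝ) < r := by exact_mod_cast hr0
    have hL : (lmod r q₁ q₂ : ℝ) * g = (q₁ : ℝ) * q₂ * r := by exact_mod_cast lmod_mul_gcd r q₁ q₂
    have hLpos : (0 : ℝ) < lmod r q₁ q₂ := by exact_mod_cast lmod_pos hr0 hq₁0 hq₂0
    have hLinv : ((lmod r q₁ q₂ : ℕ) : ℝ)⁻¹ = g / ((q₁ : ℝ) * q₂ * r) := by
      rw [eq_div_iff (by positivity), ← hL]; field_simp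
    have hgmod : ((gmod r q₁ q₂ : ℕ) : ℝ) = (g : ℝ) * r := by unfold gmod; rw [← hg]; push_cast; ring
    rw [div_eq_mul_inv (|γ q₁| * |γ q₂|), hLinv, hgmod]
    have e : |γ q₁| * |γ q₂| * ((g : ℝ) / ((q₁ : ℝ) * q₂ * r)) *
        (Lg * (2 * N / (z * ((g : ℝ) * r)) + 1) * l2Sq N β) =
        (|γ q₁| * |γ q₂|) * (l2Sq N β * Lg) *
          (((2 * N / z) * (r : ℝ)⁻¹ + g) * (1 / (r : ℝ))) / ((q₁ : ℝ) * q₂) := by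
      field_simp
    rw [e]
    have hA : (|γ q₁| * |γ q₂|) * (l2Sq N β * Lg) ≤
        ((σ 0 q₁ : ℝ) ^ b * (σ 0 q₂ : ℝ) ^ b) * (l2Sq N β * (2 * Real.log (2 * N))) :=
      mul_le_mul hγγ (mul_le_mul_of_nonneg_left hlg hl2) (by positivity) (by positivity)
    have hB : ((2 * N / z) * (r : ℝ)⁻¹ + g) * (1 / (r : ℝ)) ≤ ((2 * N / z) * R⁻¹ + Q₀) * (1 / (r : ℝ)) := by
      refine mul_le_mul_of_nonneg_right (add_le_add (mul_le_mul_of_nonneg_left (inv_anti₀ hR0 hrb.le)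
        (by positivity)) hgQ₀) (by positivity)
    have hB0 : 0 ≤ ((2 * N / z) * (r : ℝ)⁻¹ + g) * (1 / (r : ℝ)) := by positivity
    exact div_le_div_of_nonneg_right (mul_le_mul hA hB hB0 (by positivity)) (by positivity)
  calc _ ≤ ∑ r ∈ dyadic R, ((σ 0 q₁ : ℝ) ^ b * (σ 0 q₂ : ℝ) ^ b) * (l2Sq N β * (2 * Real.log (2 * N))) *
        (((2 * N / z) * R⁻¹ + Q₀) * (1 / (r : ℝ))) / ((q₁ : ℝ) * q₂) := Finset.sum_le_sum hterm
    _ = ((σ 0 q₁ : ℝ) ^ b * (σ 0 q₂ : ℝ) ^ b) * (l2Sq N β * (2 * Real.log (2 * N))) *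
        (((2 * N / z) * R⁻¹ + Q₀) * ∑ r ∈ dyadic R, (1 / (r : ℝ))) / ((q₁ : ℝ) * q₂) := by
        rw [Finset.mul_sum, Finset.mul_sum, Finset.sum_div]
    _ ≤ ((σ 0 q₁ : ℝ) ^ b * (σ 0 q₂ : ℝ) ^ b) * (l2Sq N β * (2 * Real.log (2 * N))) *
        (((2 * N / z) * R⁻¹ + Q₀) * 4) / ((q₁ : ℝ) * q₂) := by
        have hs := sum_dyadic_inv_le hR
        gcongr
    _ = _ := by field_simp; ring

/-- **E6 (a)+(b)** summed over the pairs: for `Q > 0`, `R ≥ 1/2`, `N ≥ 1/2`, `z > 0`, `W ≥ 0` and the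
moments for `τ^{2b}`, `τ^b`, the sum over `r, q₁, q₂` of the first branch of `BFI.xErr` is at most
`(W Q₀/R)(4C(log 4Q)^k)² + ‖β‖² · 2 log(2N) · (8N/(zR) + 4Q₀) (4C'(log 4Q)^{k'})²`.
[cite: BombieriFriedlanderIwaniecActa1986, §7 (7.1)–(7.4) pp. 222–223] -/
theorem e6ab_le {N Q R Q₀ z W : ℝ} (hN : 1 / 2 ≤ N) (hQ : 1 / 2 ≤ Q) (hR : 1 / 2 ≤ R)
    (hz : 0 < z) (hW : 0 ≤ W) (β : ℕ → ℝ) {γ : ℕ → ℝ} {b : ℕ}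
    (hγ : ∀ q, |γ q| ≤ (σ 0 q : ℝ) ^ b)
    (hBDH : ∀ d : ℕ, 1 ≤ d → ∑ q ∈ Icc 1 ⌊2 * Q₀ * R⌋₊, bdhD N β d q ≤ W * (σ 0 d : ℝ) ^ b)
    {C C' : ℝ} {k k' : ℕ} (h : MomentHyp (2 * b) C k) (h' : MomentHyp b C' k') (hQ₀ : 0 ≤ Q₀) :
    ∑ r ∈ dyadic R, ∑ q₁ ∈ dyadic Q, ∑ q₂ ∈ dyadic Q,
      (if (Nat.gcd q₁ q₂ : ℝ) ≤ Q₀ then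
        |γ q₁| * |γ q₂| / (lmod r q₁ q₂ : ℝ) *
            ((bdhD N β (q₁ / Nat.gcd q₁ q₂) (gmod r q₁ q₂) +
              bdhD N β (q₂ / Nat.gcd q₁ q₂) (gmod r q₁ q₂)) / 2) +
          |γ q₁| * |γ q₂| / (lmod r q₁ q₂ : ℝ) *
            (((Nat.log 2 ⌊2 * N⌋₊ : ℝ) * (2 * N / (z * (gmod r q₁ q₂ : ℝ)) + 1)) * l2Sq N β)
        else 0) ≤
      W * Q₀ / R * (4 * C * Real.log (4 * Q) ^ k) ^ 2 +
        l2Sq N β * (2 * Real.log (2 * N)) * (8 * N / (z * R) + 4 * Q₀) *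
          (4 * C' * Real.log (4 * Q) ^ k') ^ 2 := by
  classical
  have hQ0 : 0 < Q := by linarith
  have hR0 : 0 < R := by linarith
  have hN0 : 0 < N := by linarith
  have hl2 := l2Sq_nonneg N β
  have hlog2N : 0 ≤ Real.log (2 * N) := Real.log_nonneg (by linarith)
  calc _ = ∑ q₁ ∈ dyadic Q, ∑ q₂ ∈ dyadic Q, ∑ r ∈ dyadic R,
        (if (Nat.gcd q₁ q₂ : ℝ) ≤ Q₀ then
          |γ q₁| * |γ q₂| / (lmod r q₁ q₂ : ℝ) *
              ((bdhD N β (q₁ / Nat.gcd q₁ q₂) (gmod r q₁ q₂) +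
                bdhD N β (q₂ / Nat.gcd q₁ q₂) (gmod r q₁ q₂)) / 2) +
            |γ q₁| * |γ q₂| / (lmod r q₁ q₂ : ℝ) *
              (((Nat.log 2 ⌊2 * N⌋₊ : ℝ) * (2 * N / (z * (gmod r q₁ q₂ : ℝ)) + 1)) * l2Sq N β)
          else 0) := by
        rw [Finset.sum_comm]; exact Finset.sum_congr rfl fun q₁ _ => Finset.sum_comm
    _ ≤ ∑ q₁ ∈ dyadic Q, ∑ q₂ ∈ dyadic Q,
        ((W * Q₀ / R) * ((σ 0 q₁ : ℝ) ^ (2 * b) / q₁ * ((σ 0 q₂ : ℝ) ^ (2 * b) / q₂)) +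
          (l2Sq N β * (2 * Real.log (2 * N)) * (8 * N / (z * R) + 4 * Q₀)) *
            ((σ 0 q₁ : ℝ) ^ b / q₁ * ((σ 0 q₂ : ℝ) ^ b / q₂))) := by
        refine Finset.sum_le_sum fun q₁ hq₁ => Finset.sum_le_sum fun q₂ hq₂ => ?_
        by_cases hle : (Nat.gcd q₁ q₂ : ℝ) ≤ Q₀
        · simp only [if_pos hle]
          rw [Finset.sum_add_distrib]
          exact add_le_add (e6a_pair_le hQ0 hR0 hW β hγ hBDH hq₁ hq₂ hle)
            (e6b_pair_le hN hQ0 hR hz β hγ hq₁ hq₂ hle)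
        · simp only [if_neg hle, Finset.sum_const_zero]
          positivity
    _ = (W * Q₀ / R) * (∑ q ∈ dyadic Q, (σ 0 q : ℝ) ^ (2 * b) / q) ^ 2 +
          (l2Sq N β * (2 * Real.log (2 * N)) * (8 * N / (z * R) + 4 * Q₀)) *
            (∑ q ∈ dyadic Q, (σ 0 q : ℝ) ^ b / q) ^ 2 := by
        rw [sq, sq, Finset.sum_mul_sum, Finset.sum_mul_sum, Finset.mul_sum, Finset.mul_sum,
          ← Finset.sum_add_distrib]
        refine Finset.sum_congr rfl fun q₁ _ => ?_
        rw [Finset.mul_sum, Finset.mul_sum, ← Finset.sum_add_distrib]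
    _ ≤ _ := by
        have hA := h.sum_dyadic_div_le hQ
        have hB := h'.sum_dyadic_div_le hQ
        have hA0 : 0 ≤ ∑ q ∈ dyadic Q, (σ 0 q : ℝ) ^ (2 * b) / q := Finset.sum_nonneg fun _ _ => by positivity
        have hB0 : 0 ≤ ∑ q ∈ dyadic Q, (σ 0 q : ℝ) ^ b / q := Finset.sum_nonneg fun _ _ => by positivity
        gcongr


/-- **E6** (BFI §7: `𝒳 = X + O(‖β‖²NR⁻¹ℒ^{−A})`, through Theorem 0 (a)): with the BDH input `W`,
`|γ_q| ≤ τ(q)^b`, (A₄) at level `z ≥ 1`, `N, Q, R ≥ 1/2`, `Q₀ ≥ 1` and the divisor moments,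
`‖α̂₀‖ |𝒳 − X| ≤ (M+2Y) · {E6(a)+(b) + E6(c)}` with the explicit right-hand sides of
`BFI.e6ab_le` and `BFI.e6c_le`. [cite: BombieriFriedlanderIwaniecActa1986, §7 (7.1)–(7.5) pp. 222–223] -/
theorem e6_le {M Y : ℝ} (hY : 0 < Y) (hYM : Y ≤ M) (a : ℤ) {N Q R Q₀ z W : ℝ} (hN : 1 / 2 ≤ N)
    (hQ : 1 / 2 ≤ Q) (hR : 1 / 2 ≤ R) (hQ₀ : 1 ≤ Q₀) (hz : 1 ≤ z) (hW : 0 ≤ W) {β γ : ℕ → ℝ}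
    {b : ℕ} (hγ : ∀ q, |γ q| ≤ (σ 0 q : ℝ) ^ b) (hsift : IsSifted (dyadic N) z β)
    (hBDH : ∀ d : ℕ, 1 ≤ d → ∑ q ∈ Icc 1 ⌊2 * Q₀ * R⌋₊, bdhD N β d q ≤ W * (σ 0 d : ℝ) ^ b)
    {C C' C₁ C'' : ℝ} {k k' k₁ k'' : ℕ} (h : MomentHyp (2 * b) C k) (h' : MomentHyp b C' k')
    (h₁ : MomentHyp 1 C₁ k₁) (h'' : MomentHyp (2 * b + 1) C'' k'') (hC₁ : 0 ≤ C₁) (hC' : 0 ≤ C')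
    (hC'' : 0 ≤ C'') :
    ‖alphaHat M Y‖ * |calX a N Q R Q₀ β γ - mainX a N Q R β γ| ≤
      (M + 2 * Y) *
        ((W * Q₀ / R * (4 * C * Real.log (4 * Q) ^ k) ^ 2 +
          l2Sq N β * (2 * Real.log (2 * N)) * (8 * N / (z * R) + 4 * Q₀) *
            (4 * C' * Real.log (4 * Q) ^ k') ^ 2) +
        ((2 * N + 1) * l2Sq N β) * (4 * C₁ * Real.log (4 * R) ^ k₁ / R) *
          ((4 * C' * (1 + Real.log (4 * Q)) ^ k') ^ 2 * (8 * C'' * Real.log (4 * (2 * Q)) ^ k'' / Q₀))) := by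
  classical
  have hM : 0 ≤ M := hY.le.trans hYM
  have hN0 : 0 ≤ N := by linarith
  have hQ0 : 0 < Q := by linarith
  have hR0 : 0 < R := by linarith
  have hz0 : 0 < z := by linarith
  have hα : ‖alphaHat M Y‖ ≤ M + 2 * Y := norm_fourier_bumpC_le hY hM 0
  have hX := abs_calX_sub_mainX_le a hN0 hQ0.le hR0.le Q₀ β γ hz hsift
  have hab := e6ab_le hN hQ hR hz0 hW β hγ hBDH h h' (by linarith) (Q₀ := Q₀)
  have hc := e6c_le hN0 hQ hR hQ₀ β hγ h₁ h' h'' hC₁ hC' hC'' (Q₀ := Q₀)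
  -- split `xErr` into its two branches
  have hsplit : ∑ r ∈ dyadic R, ∑ q₁ ∈ dyadic Q, ∑ q₂ ∈ dyadic Q, xErr N Q₀ z β γ r q₁ q₂ =
      (∑ r ∈ dyadic R, ∑ q₁ ∈ dyadic Q, ∑ q₂ ∈ dyadic Q,
        (if (Nat.gcd q₁ q₂ : ℝ) ≤ Q₀ then
          |γ q₁| * |γ q₂| / (lmod r q₁ q₂ : ℝ) *
              ((bdhD N β (q₁ / Nat.gcd q₁ q₂) (gmod r q₁ q₂) +
                bdhD N β (q₂ / Nat.gcd q₁ q₂) (gmod r q₁ q₂)) / 2) +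
            |γ q₁| * |γ q₂| / (lmod r q₁ q₂ : ℝ) *
              (((Nat.log 2 ⌊2 * N⌋₊ : ℝ) * (2 * N / (z * (gmod r q₁ q₂ : ℝ)) + 1)) * l2Sq N β)
          else 0)) +
      ∑ r ∈ dyadic R, ∑ q₁ ∈ dyadic Q, ∑ q₂ ∈ dyadic Q,
        (if (Nat.gcd q₁ q₂ : ℝ) ≤ Q₀ then 0 else
          |γ q₁| * |γ q₂| * (∑ n ∈ dyadic N, |β n|) ^ 2 /
            ((lmod r q₁ q₂ : ℝ) * (Nat.totient (gmod r q₁ q₂) : ℝ))) := by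
    rw [← Finset.sum_add_distrib]
    refine Finset.sum_congr rfl fun r _ => ?_
    rw [← Finset.sum_add_distrib]
    refine Finset.sum_congr rfl fun q₁ _ => ?_
    rw [← Finset.sum_add_distrib]
    refine Finset.sum_congr rfl fun q₂ _ => ?_
    unfold xErr
    split_ifs <;> simp
  calc ‖alphaHat M Y‖ * |calX a N Q R Q₀ β γ - mainX a N Q R β γ|
      ≤ (M + 2 * Y) * ∑ r ∈ dyadic R, ∑ q₁ ∈ dyadic Q, ∑ q₂ ∈ dyadic Q, xErr N Q₀ z β γ r q₁ q₂ :=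
        mul_le_mul hα hX (abs_nonneg _) (by positivity)
    _ ≤ _ := by
        rw [hsplit]
        exact mul_le_mul_of_nonneg_left (add_le_add hab hc) (by positivity)


/-! ## E3: the Poisson tails and phase errors of `𝒮₁ᶜ(β♭)` (BFI (6.9)–(6.12)) -/

/-- Factorisation of a separable fourfold sum. [folklore] -/
theorem sum₄_mul_eq (A B : Finset ℕ) (f g : ℕ → ℝ) (K : ℝ) :
    ∑ q₁ ∈ A, ∑ q₂ ∈ A, ∑ n₁ ∈ B, ∑ n₂ ∈ B, K * ((f q₁ * f q₂) * (g n₁ * g n₂)) =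
      K * ((∑ q ∈ A, f q) ^ 2 * (∑ n ∈ B, g n) ^ 2) := by
  have hg : ∀ c : ℝ, ∑ n₁ ∈ B, ∑ n₂ ∈ B, c * (g n₁ * g n₂) = c * (∑ n ∈ B, g n) ^ 2 := by
    intro c
    rw [sq, Finset.sum_mul_sum, Finset.mul_sum]
    refine Finset.sum_congr rfl fun n₁ _ => ?_
    rw [Finset.mul_sum]
  have e1 : ∀ q₁ q₂, ∑ n₁ ∈ B, ∑ n₂ ∈ B, K * ((f q₁ * f q₂) * (g n₁ * g n₂)) =
      (K * (f q₁ * f q₂)) * (∑ n ∈ B, g n) ^ 2 := by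
    intro q₁ q₂
    rw [← hg]
    refine Finset.sum_congr rfl fun n₁ _ => Finset.sum_congr rfl fun n₂ _ => by ring
  simp_rw [e1]
  rw [sq (∑ q ∈ A, f q), Finset.sum_mul_sum]
  rw [Finset.sum_mul, Finset.mul_sum]
  refine Finset.sum_congr rfl fun q₁ _ => ?_
  rw [Finset.sum_mul, Finset.mul_sum]
  refine Finset.sum_congr rfl fun q₂ _ => by ring


/-- On the main range the modulus `L = [q₁,q₂]r` satisfies `Q²R/Q₀ < L ≤ 8Q²R`. [folklore] -/
theorem lmod_bounds {Q R Q₀ : ℝ} (hQ : 0 < Q) (hR : 0 < R) (hQ₀ : 0 < Q₀) {r q₁ q₂ n₁ n₂ : ℕ}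
    (hr : r ∈ dyadic R) (hq₁ : q₁ ∈ dyadic Q) (hq₂ : q₂ ∈ dyadic Q) (hM : Main Q₀ q₁ q₂ n₁ n₂) :
    Q ^ 2 * R / Q₀ ≤ (lmod r q₁ q₂ : ℝ) ∧ (lmod r q₁ q₂ : ℝ) ≤ 8 * Q ^ 2 * R := by
  have hrb := (mem_dyadic hR.le).1 hr
  have hq₁b := (mem_dyadic hQ.le).1 hq₁
  have hq₂b := (mem_dyadic hQ.le).1 hq₂
  have hq₁0 := pos_of_mem_dyadic hQ.le hq₁
  have hmul : ((lmod r q₁ q₂ : ℕ) : ℝ) * (Nat.gcd q₁ q₂ : ℝ) = (q₁ : ℝ) * q₂ * r := by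
    exact_mod_cast lmod_mul_gcd r q₁ q₂
  have hg1 : (1 : ℝ) ≤ (Nat.gcd q₁ q₂ : ℝ) := by exact_mod_cast Nat.gcd_pos_of_pos_left _ hq₁0
  constructor
  · rw [div_le_iff₀ hQ₀]
    calc Q ^ 2 * R ≤ (q₁ : ℝ) * q₂ * r := by
          have h1 : Q ^ 2 ≤ (q₁ : ℝ) * q₂ := by
            rw [sq]; exact mul_le_mul hq₁b.1.le hq₂b.1.le hQ.le (by positivity)
          exact mul_le_mul h1 hrb.1.le hR.le (by positivity)
      _ = (lmod r q₁ q₂ : ℝ) * (Nat.gcd q₁ q₂ : ℝ) := hmul.symm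
      _ ≤ (lmod r q₁ q₂ : ℝ) * Q₀ := mul_le_mul_of_nonneg_left hM.2 (by positivity)
  · calc ((lmod r q₁ q₂ : ℕ) : ℝ) = (lmod r q₁ q₂ : ℝ) * 1 := (mul_one _).symm
      _ ≤ (lmod r q₁ q₂ : ℝ) * (Nat.gcd q₁ q₂ : ℝ) := mul_le_mul_of_nonneg_left hg1 (by positivity)
      _ = (q₁ : ℝ) * q₂ * r := hmul
      _ ≤ (2 * Q) * (2 * Q) * (2 * R) := by
          refine mul_le_mul (mul_le_mul hq₁b.2 hq₂b.2 (by positivity) (by positivity)) hrb.2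
            (by positivity) (by positivity)
      _ = 8 * Q ^ 2 * R := by ring

/-- **E3** (BFI (6.9)–(6.12): the Poisson tails and the phase errors of `𝒮₁ᶜ` are admissible), in
pre-asymptotic form for any coefficients `β'` with `|β'| ≤ |β|` (downstream `β' = β♭`): with
`θ ≥ 8Q²R/(2πY(H+1))` (the decay ratio of the tail beyond `H`), `j ≥ 2`, `|γ_q| ≤ τ(q)^b`,
`‖𝒮₁ᶜ(β') − α̂₀𝒳(β') − ℛ₁(β')‖ ≤ {(Q₀/(Q²R)) 16K_j Y (H+1) θʲ + (Q₀/(Q²R))² 4π|a|(M+2Y)H²/N}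
   · (2R+1)(4C_bQ(log 4Q)^{k})²(2N+1)‖β‖²`.
[cite: BombieriFriedlanderIwaniecActa1986, §6 (6.9)–(6.12) pp. 220–221] -/
theorem e3_le {a : ℤ} {M Y : ℝ} (hY : 0 < Y) (hYM : Y ≤ M) {N Q R Q₀ : ℝ} (hN : 0 < N)
    (hQ : 1 / 2 ≤ Q) (hR : 1 / 2 ≤ R) (hQ₀ : 1 ≤ Q₀) {β β' γ : ℕ → ℝ} {b : ℕ}
    (hγ : ∀ q, |γ q| ≤ (σ 0 q : ℝ) ^ b) (hβ' : ∀ n, |β' n| ≤ |β n|) (H : ℕ) {j : ℕ} (hj : 2 ≤ j)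
    {θ : ℝ} (hθ0 : 0 ≤ θ) (hθ : 8 * Q ^ 2 * R / (2 * π * Y * ((H : ℝ) + 1)) ≤ θ)
    {Cb : ℝ} {kb : ℕ} (hb : MomentHyp b Cb kb) :
    ‖(dS1c a (mRange M Y) N Q R Q₀ (fun m => bump M Y m) β' γ : ℂ) -
        alphaHat M Y * (calX a N Q R Q₀ β' γ : ℂ) - calR1 a M Y N Q R Q₀ β' γ H‖ ≤
      (Q₀ / (Q ^ 2 * R) * (16 * derivConst j * (Y * ((H : ℝ) + 1)) * θ ^ j) +
        (Q₀ / (Q ^ 2 * R)) ^ 2 * (4 * π * |(a : ℝ)| * (M + 2 * Y) * (H : ℝ) ^ 2 / N)) *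
      ((2 * R + 1) * (4 * Cb * Q * Real.log (4 * Q) ^ kb) ^ 2 * ((2 * N + 1) * l2Sq N β)) := by
  classical
  have hM : 0 ≤ M := hY.le.trans hYM
  have hQ0 : 0 < Q := by linarith
  have hR0 : 0 < R := by linarith
  have hQ₀0 : 0 < Q₀ := by linarith
  have hj1 : 1 ≤ j := by omega
  set E : ℝ := Q₀ / (Q ^ 2 * R) * (16 * derivConst j * (Y * ((H : ℝ) + 1)) * θ ^ j) +
    (Q₀ / (Q ^ 2 * R)) ^ 2 * (4 * π * |(a : ℝ)| * (M + 2 * Y) * (H : ℝ) ^ 2 / N) with hE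
  have hKj := one_le_derivConst j
  have hE0 : 0 ≤ E := by positivity
  -- pointwise bound for `errS1` on the main range
  have herr : ∀ r ∈ dyadic R, ∀ q₁ ∈ dyadic Q, ∀ q₂ ∈ dyadic Q, ∀ n₁ ∈ dyadic N, ∀ n₂ : ℕ,
      Main Q₀ q₁ q₂ n₁ n₂ → errS1 a M Y j H r q₁ q₂ n₁ ≤ E := by
    intro r hr q₁ hq₁ q₂ hq₂ n₁ hn₁ n₂ hMain
    obtain ⟨hL1, hL2⟩ := lmod_bounds hQ0 hR0 hQ₀0 hr hq₁ hq₂ hMain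
    have hLpos : (0 : ℝ) < lmod r q₁ q₂ := by
      exact_mod_cast lmod_pos (pos_of_mem_dyadic hR0.le hr) (pos_of_mem_dyadic hQ0.le hq₁)
        (pos_of_mem_dyadic hQ0.le hq₂)
    have hLinv : ((lmod r q₁ q₂ : ℕ) : ℝ)⁻¹ ≤ Q₀ / (Q ^ 2 * R) := by
      rw [inv_eq_one_div, div_le_div_iff₀ hLpos (by positivity), one_mul]
      rw [div_le_iff₀ hQ₀0] at hL1; linarith
    have hn₁b := ((mem_dyadic hN.le).1 hn₁).1
    have hn₁0 : (0 : ℝ) < n₁ := by linarith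
    -- the tail
    have htail : tailBound Y j (lmod r q₁ q₂) H ≤ 16 * derivConst j * (Y * ((H : ℝ) + 1)) * θ ^ j := by
      refine tailBound_le_of hY hj1 (le_trans ?_ hθ)
      exact div_le_div_of_nonneg_right hL2 (by positivity)
    unfold errS1
    refine add_le_add ?_ ?_
    · exact mul_le_mul hLinv htail (tailBound_nonneg hY _ _ _) (by positivity)
    · -- phase: `L⁻¹ 2(M+2Y) 2π|a|H²/(L n₁) ≤ (Q₀/(Q²R))² 4π|a|(M+2Y)H²/N`
      have h1 : |(a : ℝ)| * (H : ℝ) ^ 2 / ((lmod r q₁ q₂ : ℝ) * n₁) ≤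
          |(a : ℝ)| * (H : ℝ) ^ 2 * (Q₀ / (Q ^ 2 * R)) / N := by
        rw [div_le_div_iff₀ (by positivity) hN]
        have e : |(a : ℝ)| * (H : ℝ) ^ 2 * (Q₀ / (Q ^ 2 * R)) * ((lmod r q₁ q₂ : ℝ) * n₁) =
            |(a : ℝ)| * (H : ℝ) ^ 2 * n₁ * ((Q₀ / (Q ^ 2 * R)) * (lmod r q₁ q₂ : ℝ)) := by ring
        rw [e]
        have h2 : 1 ≤ (Q₀ / (Q ^ 2 * R)) * (lmod r q₁ q₂ : ℝ) := by
          rw [div_mul_eq_mul_div, le_div_iff₀ (by positivity)]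
          rw [div_le_iff₀ hQ₀0] at hL1; linarith
        calc |(a : ℝ)| * (H : ℝ) ^ 2 * N ≤ |(a : ℝ)| * (H : ℝ) ^ 2 * n₁ := by gcongr
          _ = |(a : ℝ)| * (H : ℝ) ^ 2 * n₁ * 1 := (mul_one _).symm
          _ ≤ _ := mul_le_mul_of_nonneg_left h2 (by positivity)
      calc ((lmod r q₁ q₂ : ℕ) : ℝ)⁻¹ * (2 * (M + 2 * Y)) *
            (2 * π * (|(a : ℝ)| * (H : ℝ) ^ 2 / ((lmod r q₁ q₂ : ℝ) * n₁)))
          ≤ (Q₀ / (Q ^ 2 * R)) * (2 * (M + 2 * Y)) *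
            (2 * π * (|(a : ℝ)| * (H : ℝ) ^ 2 * (Q₀ / (Q ^ 2 * R)) / N)) := by
            gcongr
        _ = _ := by ring
  -- sum
  refine (norm_dS1c_sub_calX_sub_calR1_le hY hYM hN.le hQ0.le hR0.le Q₀ β' γ H hj).trans ?_
  have hβs : ∑ n ∈ dyadic N, |β' n| ≤ ∑ n ∈ dyadic N, |β n| := Finset.sum_le_sum fun n _ => hβ' n
  have hβ2 : (∑ n ∈ dyadic N, |β n|) ^ 2 ≤ (2 * N + 1) * l2Sq N β := by
    have h := sum_abs_le_sqrt_l2Sq hN.le β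
    have h0 : 0 ≤ ∑ n ∈ dyadic N, |β n| := Finset.sum_nonneg fun _ _ => abs_nonneg _
    calc (∑ n ∈ dyadic N, |β n|) ^ 2 ≤ (Real.sqrt (l2Sq N β) * Real.sqrt (2 * N + 1)) ^ 2 :=
          pow_le_pow_left₀ h0 h 2
      _ = (2 * N + 1) * l2Sq N β := by
          rw [mul_pow, Real.sq_sqrt (l2Sq_nonneg N β), Real.sq_sqrt (by linarith)]; ring
  have hβ's0 : 0 ≤ ∑ n ∈ dyadic N, |β' n| := Finset.sum_nonneg fun _ _ => abs_nonneg _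
  calc ∑ r ∈ dyadic R, ∑ q₁ ∈ dyadic Q, ∑ q₂ ∈ dyadic Q, ∑ n₁ ∈ dyadic N, ∑ n₂ ∈ dyadic N,
        (if Main Q₀ q₁ q₂ n₁ n₂ ∧ Solvable a r q₁ q₂ n₁ n₂ then
          |γ q₁ * γ q₂ * β' n₁ * β' n₂| * errS1 a M Y j H r q₁ q₂ n₁ else 0)
      ≤ ∑ r ∈ dyadic R, ∑ q₁ ∈ dyadic Q, ∑ q₂ ∈ dyadic Q, ∑ n₁ ∈ dyadic N, ∑ n₂ ∈ dyadic N,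
          E * ((|γ q₁| * |γ q₂|) * (|β' n₁| * |β' n₂|)) := by
        refine Finset.sum_le_sum fun r hr => Finset.sum_le_sum fun q₁ hq₁ => Finset.sum_le_sum fun q₂ hq₂ =>
          Finset.sum_le_sum fun n₁ hn₁ => Finset.sum_le_sum fun n₂ _ => ?_
        split_ifs with hMS
        · rw [abs_mul, abs_mul, abs_mul, mul_comm]
          calc errS1 a M Y j H r q₁ q₂ n₁ * (|γ q₁| * |γ q₂| * |β' n₁| * |β' n₂|)
              ≤ E * (|γ q₁| * |γ q₂| * |β' n₁| * |β' n₂|) :=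
                mul_le_mul_of_nonneg_right (herr r hr q₁ hq₁ q₂ hq₂ n₁ hn₁ n₂ hMS.1) (by positivity)
            _ = _ := by ring
        · positivity
    _ = E * ((dyadic R).card * ((∑ q ∈ dyadic Q, |γ q|) ^ 2 * (∑ n ∈ dyadic N, |β' n|) ^ 2)) := by
        rw [Finset.sum_const, nsmul_eq_mul, sum₄_mul_eq]; ring
    _ ≤ E * ((2 * R + 1) * ((4 * Cb * Q * Real.log (4 * Q) ^ kb) ^ 2 * ((2 * N + 1) * l2Sq N β))) := by
        refine mul_le_mul_of_nonneg_left ?_ hE0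
        have hcard := card_dyadic_le hR0.le
        have hγ2 := sum_abs_gamma_sq_le hγ hb hQ
        have hβ'2 : (∑ n ∈ dyadic N, |β' n|) ^ 2 ≤ (2 * N + 1) * l2Sq N β :=
          (pow_le_pow_left₀ hβ's0 hβs 2).trans hβ2
        exact mul_le_mul hcard (mul_le_mul hγ2 hβ'2 (sq_nonneg _) (sq_nonneg _)) (by positivity)
          (by positivity)
    _ = _ := by ring


/-! ## E1: `𝒮₁` off the main range (BFI (6.3)–(6.4)), from `BFI.abs_dS1n_le` -/

/-- For `u ≥ 1` real and any `B`, `u^B ≤ u^{⌈B⌉}`. [folklore] -/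
theorem rpow_le_pow_ceil {u : ℝ} (hu : 1 ≤ u) (B : ℝ) : u ^ B ≤ u ^ (⌈B⌉₊) := by
  calc u ^ B ≤ u ^ ((⌈B⌉₊ : ℕ) : ℝ) := Real.rpow_le_rpow_of_exponent_le hu (Nat.le_ceil B)
    _ = _ := Real.rpow_natCast _ _

set_option maxHeartbeats 800000 in
/-- The per-`(r, q₁)` bound behind E1: the bracket of `BFI.abs_dS1n_le` at `(r, q₁)`, multiplied by
`|γ_{q₁}|`, is at most `K₁ τ(q₁)^{b+b₄}/q₁ · τ(r)^{b₃+b₄}/r² + K₃ τ(q₁)^{b+1+b₃+b₄}/q₁ · τ(r)^{b₃+b₄}/r²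
 + K₂ τ(q₁)^{b+1} ((2M+Y)/(q₁ r) + 1)` with
`K₁ = ω₀C₃C₄ 2N(2M+Y) 2^{B₃} lg^{B₃} lg'^{B₄}/z`, `K₃ = C₃C₄ 2N(2M+Y) lg^{B₃} lg'^{B₄}/Q₀`,
`K₂ = T(2N/(P₀R)+1)(ω₀+1)` (`lg' = log(2M+Y)`, `bᵢ = ⌈Bᵢ⌉`). [folklore] -/
theorem e1_pair_le {M Y N R Q₀ z C₃ B₃ C₄ B₄ P₀ T lg ω₀ : ℝ} (hMY : 1 ≤ 2 * M + Y) (hN : 0 ≤ N)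
    (hQ₀ : 0 < Q₀) (hz : 0 < z) (hC₃ : 0 ≤ C₃) (hC₄ : 0 ≤ C₄) (hB₄ : 0 ≤ B₄)
    (hT : 0 ≤ T) (hω₀ : 0 ≤ ω₀) (hlg : 0 ≤ lg) (hP₀ : 0 < P₀) (hR : 0 < R) {γ : ℕ → ℝ} {b : ℕ}
    (hγ : ∀ q, |γ q| ≤ (σ 0 q : ℝ) ^ b) {r q₁ : ℕ} (hr : 0 < r) (hq₁ : 0 < q₁) :
    |γ q₁| *
        (ω₀ * (C₃ * (2 * N / r) * (2 * (σ 0 r : ℝ) * lg) ^ B₃ / z *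
            (C₄ * ((2 * M + Y) / ((q₁ * r : ℕ) : ℝ)) * ((σ 0 (q₁ * r) : ℝ) * Real.log (2 * M + Y)) ^ B₄) +
            T * (2 * N / (P₀ * R) + 1) * ((2 * M + Y) / ((q₁ * r : ℕ) : ℝ) + 1)) +
          (σ 0 q₁ : ℝ) * (C₃ * (2 * N / (Q₀ * r)) * ((σ 0 q₁ : ℝ) * (σ 0 r : ℝ) * lg) ^ B₃ *
            (C₄ * ((2 * M + Y) / ((q₁ * r : ℕ) : ℝ)) * ((σ 0 (q₁ * r) : ℝ) * Real.log (2 * M + Y)) ^ B₄) +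
            T * (2 * N / (P₀ * R) + 1) * ((2 * M + Y) / ((q₁ * r : ℕ) : ℝ) + 1))) ≤
      (ω₀ * C₃ * C₄ * (2 * N) * (2 * M + Y) * (2 : ℝ) ^ B₃ * lg ^ B₃ * Real.log (2 * M + Y) ^ B₄ / z) *
          ((σ 0 q₁ : ℝ) ^ (b + ⌈B₄⌉₊) / q₁ * ((σ 0 r : ℝ) ^ (⌈B₃⌉₊ + ⌈B₄⌉₊) / (r : ℝ) ^ 2)) +
        (C₃ * C₄ * (2 * N) * (2 * M + Y) * lg ^ B₃ * Real.log (2 * M + Y) ^ B₄ / Q₀) *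
          ((σ 0 q₁ : ℝ) ^ (b + 1 + ⌈B₃⌉₊ + ⌈B₄⌉₊) / q₁ * ((σ 0 r : ℝ) ^ (⌈B₃⌉₊ + ⌈B₄⌉₊) / (r : ℝ) ^ 2)) +
        (T * (2 * N / (P₀ * R) + 1) * (ω₀ + 1)) *
          ((σ 0 q₁ : ℝ) ^ (b + 1) * ((2 * M + Y) / ((q₁ : ℝ) * r) + 1)) := by
  set b₃ := ⌈B₃⌉₊ with hb₃
  set b₄ := ⌈B₄⌉₊ with hb₄
  set lg' := Real.log (2 * M + Y) with hlg'
  have hlg'0 : 0 ≤ lg' := Real.log_nonneg hMY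
  have hq₁r : (0 : ℝ) < q₁ := by exact_mod_cast hq₁
  have hrr : (0 : ℝ) < r := by exact_mod_cast hr
  have hτq : (1 : ℝ) ≤ (σ 0 q₁ : ℝ) := by exact_mod_cast one_le_sigma_zero hq₁.ne'
  have hτr : (1 : ℝ) ≤ (σ 0 r : ℝ) := by exact_mod_cast one_le_sigma_zero hr.ne'
  have hcast : ((q₁ * r : ℕ) : ℝ) = (q₁ : ℝ) * r := by push_cast; ring
  -- the three rpow conversions
  have h1 : (2 * (σ 0 r : ℝ) * lg) ^ B₃ ≤ (2 : ℝ) ^ B₃ * (σ 0 r : ℝ) ^ b₃ * lg ^ B₃ := by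
    rw [Real.mul_rpow (by positivity) hlg, Real.mul_rpow (by norm_num) (by positivity)]
    gcongr
    exact rpow_le_pow_ceil hτr B₃
  have h2 : ((σ 0 q₁ : ℝ) * (σ 0 r : ℝ) * lg) ^ B₃ ≤ (σ 0 q₁ : ℝ) ^ b₃ * (σ 0 r : ℝ) ^ b₃ * lg ^ B₃ := by
    rw [Real.mul_rpow (by positivity) hlg, Real.mul_rpow (by positivity) (by positivity)]
    gcongr
    · exact rpow_le_pow_ceil hτq B₃
    · exact rpow_le_pow_ceil hτr B₃
  have h3 : ((σ 0 (q₁ * r) : ℝ) * lg') ^ B₄ ≤ (σ 0 q₁ : ℝ) ^ b₄ * (σ 0 r : ℝ) ^ b₄ * lg' ^ B₄ := by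
    have hτ : (σ 0 (q₁ * r) : ℝ) ≤ (σ 0 q₁ : ℝ) * (σ 0 r : ℝ) := by exact_mod_cast sigma_zero_mul_le q₁ r
    calc ((σ 0 (q₁ * r) : ℝ) * lg') ^ B₄ ≤ ((σ 0 q₁ : ℝ) * (σ 0 r : ℝ) * lg') ^ B₄ :=
          Real.rpow_le_rpow (by positivity) (mul_le_mul_of_nonneg_right hτ hlg'0) hB₄
      _ = (σ 0 q₁ : ℝ) ^ B₄ * (σ 0 r : ℝ) ^ B₄ * lg' ^ B₄ := by
          rw [Real.mul_rpow (by positivity) hlg'0, Real.mul_rpow (by positivity) (by positivity)]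
      _ ≤ _ := by
          gcongr
          · exact rpow_le_pow_ceil hτq B₄
          · exact rpow_le_pow_ceil hτr B₄
  -- `L₄ ≤ C₄ (2M+Y)/(q₁r) τq₁^{b₄} τr^{b₄} lg'^{B₄}`
  have hL4 : C₄ * ((2 * M + Y) / ((q₁ * r : ℕ) : ℝ)) * ((σ 0 (q₁ * r) : ℝ) * lg') ^ B₄ ≤
      C₄ * ((2 * M + Y) / ((q₁ : ℝ) * r)) * ((σ 0 q₁ : ℝ) ^ b₄ * (σ 0 r : ℝ) ^ b₄ * lg' ^ B₄) := by
    rw [hcast]; exact mul_le_mul_of_nonneg_left h3 (by positivity)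
  have hL40 : 0 ≤ C₄ * ((2 * M + Y) / ((q₁ * r : ℕ) : ℝ)) * ((σ 0 (q₁ * r) : ℝ) * lg') ^ B₄ := by
    rw [hcast]; positivity
  -- the `T`-bracket
  have hTb : T * (2 * N / (P₀ * R) + 1) * ((2 * M + Y) / ((q₁ * r : ℕ) : ℝ) + 1) =
      T * (2 * N / (P₀ * R) + 1) * ((2 * M + Y) / ((q₁ : ℝ) * r) + 1) := by rw [hcast]
  have hTb0 : 0 ≤ T * (2 * N / (P₀ * R) + 1) * ((2 * M + Y) / ((q₁ : ℝ) * r) + 1) := by positivity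
  -- first piece (ω₀-part)
  have hA : |γ q₁| * (ω₀ * (C₃ * (2 * N / r) * (2 * (σ 0 r : ℝ) * lg) ^ B₃ / z *
        (C₄ * ((2 * M + Y) / ((q₁ * r : ℕ) : ℝ)) * ((σ 0 (q₁ * r) : ℝ) * lg') ^ B₄))) ≤
      (ω₀ * C₃ * C₄ * (2 * N) * (2 * M + Y) * (2 : ℝ) ^ B₃ * lg ^ B₃ * lg' ^ B₄ / z) *
        ((σ 0 q₁ : ℝ) ^ (b + b₄) / q₁ * ((σ 0 r : ℝ) ^ (b₃ + b₄) / (r : ℝ) ^ 2)) := by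
    have hγ₁ := hγ q₁
    calc _ ≤ (σ 0 q₁ : ℝ) ^ b * (ω₀ * (C₃ * (2 * N / r) * ((2 : ℝ) ^ B₃ * (σ 0 r : ℝ) ^ b₃ * lg ^ B₃) / z *
          (C₄ * ((2 * M + Y) / ((q₁ : ℝ) * r)) * ((σ 0 q₁ : ℝ) ^ b₄ * (σ 0 r : ℝ) ^ b₄ * lg' ^ B₄)))) := by
          refine mul_le_mul hγ₁ ?_ (by positivity) (by positivity)
          refine mul_le_mul_of_nonneg_left ?_ hω₀
          refine mul_le_mul ?_ hL4 hL40 (by positivity)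
          exact div_le_div_of_nonneg_right (mul_le_mul_of_nonneg_left h1 (by positivity)) hz.le
      _ = _ := by rw [pow_add, pow_add]; field_simp
  -- second piece (Q₀-part)
  have hB : |γ q₁| * ((σ 0 q₁ : ℝ) * (C₃ * (2 * N / (Q₀ * r)) * ((σ 0 q₁ : ℝ) * (σ 0 r : ℝ) * lg) ^ B₃ *
        (C₄ * ((2 * M + Y) / ((q₁ * r : ℕ) : ℝ)) * ((σ 0 (q₁ * r) : ℝ) * lg') ^ B₄))) ≤
      (C₃ * C₄ * (2 * N) * (2 * M + Y) * lg ^ B₃ * lg' ^ B₄ / Q₀) *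
        ((σ 0 q₁ : ℝ) ^ (b + 1 + b₃ + b₄) / q₁ * ((σ 0 r : ℝ) ^ (b₃ + b₄) / (r : ℝ) ^ 2)) := by
    have hγ₁ := hγ q₁
    calc _ ≤ (σ 0 q₁ : ℝ) ^ b * ((σ 0 q₁ : ℝ) * (C₃ * (2 * N / (Q₀ * r)) *
          ((σ 0 q₁ : ℝ) ^ b₃ * (σ 0 r : ℝ) ^ b₃ * lg ^ B₃) *
          (C₄ * ((2 * M + Y) / ((q₁ : ℝ) * r)) * ((σ 0 q₁ : ℝ) ^ b₄ * (σ 0 r : ℝ) ^ b₄ * lg' ^ B₄)))) := by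
          refine mul_le_mul hγ₁ ?_ (by positivity) (by positivity)
          refine mul_le_mul_of_nonneg_left ?_ (by positivity)
          exact mul_le_mul (mul_le_mul_of_nonneg_left h2 (by positivity)) hL4 hL40 (by positivity)
      _ = _ := by rw [pow_add, pow_add, pow_add, pow_add, pow_one]; field_simp
  -- third piece (T-parts)
  have hC : |γ q₁| * (ω₀ * (T * (2 * N / (P₀ * R) + 1) * ((2 * M + Y) / ((q₁ * r : ℕ) : ℝ) + 1)) +
      (σ 0 q₁ : ℝ) * (T * (2 * N / (P₀ * R) + 1) * ((2 * M + Y) / ((q₁ * r : ℕ) : ℝ) + 1))) ≤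
      (T * (2 * N / (P₀ * R) + 1) * (ω₀ + 1)) * ((σ 0 q₁ : ℝ) ^ (b + 1) * ((2 * M + Y) / ((q₁ : ℝ) * r) + 1)) := by
    have hγ₁ := hγ q₁
    have hωτ : ω₀ + (σ 0 q₁ : ℝ) ≤ (ω₀ + 1) * (σ 0 q₁ : ℝ) := by
      have := mul_le_mul_of_nonneg_left hτq hω₀
      linarith
    set X : ℝ := T * (2 * N / (P₀ * R) + 1) * ((2 * M + Y) / ((q₁ : ℝ) * r) + 1) with hX
    have eq1 : |γ q₁| * (ω₀ * (T * (2 * N / (P₀ * R) + 1) * ((2 * M + Y) / ((q₁ * r : ℕ) : ℝ) + 1)) +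
        (σ 0 q₁ : ℝ) * (T * (2 * N / (P₀ * R) + 1) * ((2 * M + Y) / ((q₁ * r : ℕ) : ℝ) + 1))) =
        |γ q₁| * ((ω₀ + (σ 0 q₁ : ℝ)) * X) := by rw [hTb, hX]; ring
    rw [eq1]
    calc |γ q₁| * ((ω₀ + (σ 0 q₁ : ℝ)) * X)
        ≤ (σ 0 q₁ : ℝ) ^ b * (((ω₀ + 1) * (σ 0 q₁ : ℝ)) * X) :=
          mul_le_mul hγ₁ (mul_le_mul_of_nonneg_right hωτ hTb0) (by positivity) (by positivity)
      _ = _ := by rw [hX, pow_succ]; ring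
  -- combine
  have e : |γ q₁| *
        (ω₀ * (C₃ * (2 * N / r) * (2 * (σ 0 r : ℝ) * lg) ^ B₃ / z *
            (C₄ * ((2 * M + Y) / ((q₁ * r : ℕ) : ℝ)) * ((σ 0 (q₁ * r) : ℝ) * lg') ^ B₄) +
            T * (2 * N / (P₀ * R) + 1) * ((2 * M + Y) / ((q₁ * r : ℕ) : ℝ) + 1)) +
          (σ 0 q₁ : ℝ) * (C₃ * (2 * N / (Q₀ * r)) * ((σ 0 q₁ : ℝ) * (σ 0 r : ℝ) * lg) ^ B₃ *
            (C₄ * ((2 * M + Y) / ((q₁ * r : ℕ) : ℝ)) * ((σ 0 (q₁ * r) : ℝ) * lg') ^ B₄) +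
            T * (2 * N / (P₀ * R) + 1) * ((2 * M + Y) / ((q₁ * r : ℕ) : ℝ) + 1))) =
      |γ q₁| * (ω₀ * (C₃ * (2 * N / r) * (2 * (σ 0 r : ℝ) * lg) ^ B₃ / z *
        (C₄ * ((2 * M + Y) / ((q₁ * r : ℕ) : ℝ)) * ((σ 0 (q₁ * r) : ℝ) * lg') ^ B₄))) +
      |γ q₁| * ((σ 0 q₁ : ℝ) * (C₃ * (2 * N / (Q₀ * r)) * ((σ 0 q₁ : ℝ) * (σ 0 r : ℝ) * lg) ^ B₃ *
        (C₄ * ((2 * M + Y) / ((q₁ * r : ℕ) : ℝ)) * ((σ 0 (q₁ * r) : ℝ) * lg') ^ B₄))) +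
      |γ q₁| * (ω₀ * (T * (2 * N / (P₀ * R) + 1) * ((2 * M + Y) / ((q₁ * r : ℕ) : ℝ) + 1)) +
        (σ 0 q₁ : ℝ) * (T * (2 * N / (P₀ * R) + 1) * ((2 * M + Y) / ((q₁ * r : ℕ) : ℝ) + 1))) := by ring
  rw [e]
  linarith [hA, hB, hC]


/-- `∑_{r∼R} τ(r)^c / r² ≤ 4C(log 4R)^k / R` under the moment hypothesis (`R ≥ 1/2`). [folklore] -/
theorem MomentHyp.sum_dyadic_div_sq_le {c : ℕ} {C : ℝ} {k : ℕ} (h : MomentHyp c C k) {R : ℝ}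
    (hR : 1 / 2 ≤ R) : ∑ r ∈ dyadic R, (σ 0 r : ℝ) ^ c / (r : ℝ) ^ 2 ≤ 4 * C * Real.log (4 * R) ^ k / R := by
  have hR0 : 0 < R := by linarith
  calc ∑ r ∈ dyadic R, (σ 0 r : ℝ) ^ c / (r : ℝ) ^ 2 ≤ ∑ r ∈ dyadic R, R⁻¹ * ((σ 0 r : ℝ) ^ c / r) := by
        refine Finset.sum_le_sum fun r hr => ?_
        have hb := ((mem_dyadic hR0.le).1 hr).1
        have hr0 : (0 : ℝ) < r := by linarith
        rw [show (σ 0 r : ℝ) ^ c / (r : ℝ) ^ 2 = (r : ℝ)⁻¹ * ((σ 0 r : ℝ) ^ c / r) by field_simp]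
        exact mul_le_mul_of_nonneg_right (inv_anti₀ hR0 hb.le) (by positivity)
    _ = R⁻¹ * ∑ r ∈ dyadic R, (σ 0 r : ℝ) ^ c / r := by rw [Finset.mul_sum]
    _ ≤ R⁻¹ * (4 * C * Real.log (4 * R) ^ k) := mul_le_mul_of_nonneg_left (h.sum_dyadic_div_le hR) (by positivity)
    _ = _ := by rw [inv_mul_eq_div]

set_option maxHeartbeats 800000 in
/-- **E1** (BFI (6.3)–(6.4): `𝒮₁(q₀ > Q₀) ≪ ‖β‖²x^{1+ε}Q₀⁻¹R⁻¹`-type and `𝒮₁(n₀ > N₀)` bounds), in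
pre-asymptotic form: `BFI.abs_dS1n_le` of `…DispersionS1Rest` with its divisor sums discharged by
moments.  With `K₁, K₂, K₃` as in `BFI.e1_pair_le` and the moments for `τ^{b+b₄}`, `τ^{b+1+b₃+b₄}`,
`τ^{b₃+b₄}`, `τ^{b+1}`,
`|𝒮₁ⁿ| ≤ ‖β‖² {K₁ Λ_a Λ_c/R + K₃ Λ_d Λ_c/R + K₂ ((2M+Y) Λ_e · 4 + 4C_eQ(log 4Q)^{k_e}(2R+1))}`,
`Λ_• = 4C_•(log 4Q)^{k_•}` resp. `4C_c(log 4R)^{k_c}`.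
[cite: BombieriFriedlanderIwaniecActa1986, §6 (6.3)–(6.4) p. 220] -/
theorem e1_le {a : ℤ} {M Y N Q R Q₀ z : ℝ} (hY : 0 < Y) (hYM : Y ≤ M) (hM1 : 1 ≤ M)
    (haM : (|a| : ℝ) < M - Y) (hN : 1 ≤ N) (hQ : 1 / 2 ≤ Q) (hR : 1 / 2 ≤ R) (hQ₀ : 0 < Q₀)
    {γ : ℕ → ℝ} {b : ℕ} (hγ : ∀ q, |γ q| ≤ (σ 0 q : ℝ) ^ b) (β : ℕ → ℝ) (hz : 0 < z)
    (hsift : IsSifted (dyadic N) z β)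
    {C₃ B₃ X₀ ε₃ C₄ B₄ X₀' ε₃' P₀ T lg ω₀ : ℝ} (hC₃ : 0 ≤ C₃) (hB₃ : 0 ≤ B₃) (hC₄ : 0 ≤ C₄)
    (hB₄ : 0 ≤ B₄) (hP₀ : 0 < P₀) (hT : 0 ≤ T) (hω₀ : 0 ≤ ω₀) (hlg0 : 0 ≤ lg)
    (hL3 : ∀ X : ℝ, X₀ ≤ X → ∀ k : ℕ, 0 < k → (k : ℝ) ≤ X ^ (1 - ε₃) → ∀ l : ZMod k,
      ∑ v ∈ l3Set a X k l, l3Term a ((b : ℝ) + 1) v ≤ C₃ * (X / k) * ((σ 0 k : ℝ) * Real.log X) ^ B₃)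
    (hL3' : ∀ X : ℝ, X₀' ≤ X → ∀ k : ℕ, 0 < k → (k : ℝ) ≤ X ^ (1 - ε₃') → ∀ l : ZMod k,
      ∑ v ∈ l3Set a X k l, l3Term a B₃ v ≤ C₄ * (X / k) * ((σ 0 k : ℝ) * Real.log X) ^ B₄)
    (hX₀ : X₀ ≤ 2 * (M - Y) * N) (hX₀' : X₀' ≤ 2 * M + Y)
    (hlev : ∀ m : ℕ, M - Y < (m : ℝ) → (m : ℝ) ≤ 2 * M + Y → ∀ t : ℕ, (t : ℝ) ≤ 2 * P₀ * R →
      ((m * t : ℕ) : ℝ) ≤ (2 * m * N) ^ (1 - ε₃))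
    (hlev' : ∀ k : ℕ, (k : ℝ) ≤ 4 * Q * R → (k : ℝ) ≤ (2 * M + Y) ^ (1 - ε₃'))
    (hTv : ∀ m : ℕ, (m : ℝ) ≤ 2 * M + Y → ∀ n ∈ dyadic N,
      (σ 0 (((m * n : ℕ) : ℤ) - a).toNat : ℝ) ^ ((b : ℝ) + 1) ≤ T)
    (hlg : ∀ m : ℕ, M - Y < (m : ℝ) → (m : ℝ) ≤ 2 * M + Y →
      0 ≤ Real.log (2 * m * N) ∧ Real.log (2 * m * N) ≤ lg)
    (hω : ∀ n ∈ dyadic N, (n.primeFactors.card : ℝ) ≤ ω₀)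
    {Ca Cc Cd Ce : ℝ} {ka kc kd ke : ℕ} (ha : MomentHyp (b + ⌈B₄⌉₊) Ca ka)
    (hc : MomentHyp (⌈B₃⌉₊ + ⌈B₄⌉₊) Cc kc) (hd : MomentHyp (b + 1 + ⌈B₃⌉₊ + ⌈B₄⌉₊) Cd kd)
    (he : MomentHyp (b + 1) Ce ke) (hCc : 0 ≤ Cc) (hCe : 0 ≤ Ce) :
    |dS1n a (mRange M Y) N Q R Q₀ (fun m => bump M Y m) β γ| ≤
      l2Sq N β *
        ((ω₀ * C₃ * C₄ * (2 * N) * (2 * M + Y) * (2 : ℝ) ^ B₃ * lg ^ B₃ * Real.log (2 * M + Y) ^ B₄ / z) *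
            ((4 * Ca * Real.log (4 * Q) ^ ka) * (4 * Cc * Real.log (4 * R) ^ kc / R)) +
          (C₃ * C₄ * (2 * N) * (2 * M + Y) * lg ^ B₃ * Real.log (2 * M + Y) ^ B₄ / Q₀) *
            ((4 * Cd * Real.log (4 * Q) ^ kd) * (4 * Cc * Real.log (4 * R) ^ kc / R)) +
          (T * (2 * N / (P₀ * R) + 1) * (ω₀ + 1)) *
            ((2 * M + Y) * (4 * Ce * Real.log (4 * Q) ^ ke) * 4 +
              (4 * Ce * Q * Real.log (4 * Q) ^ ke) * (2 * R + 1))) := by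
  have hM : 0 ≤ M := by linarith
  have hQ0 : 0 < Q := by linarith
  have hR0 : 0 < R := by linarith
  have hMY : 1 ≤ 2 * M + Y := by linarith
  have hl2 := l2Sq_nonneg N β
  have hγ' : ∀ q, |γ q| ≤ (σ 0 q : ℝ) ^ (b : ℝ) := fun q => by rw [Real.rpow_natCast]; exact hγ q
  have hmain := abs_dS1n_le hY hYM hM1 haM hN hQ0 hR0 hQ₀ (Nat.cast_nonneg b) hγ' β hz hsift hC₃ hB₃ hC₄
    hP₀ hT hω₀ hL3 hL3' hX₀ hX₀' hlev hlev' hTv hlg hω (a := a)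
  refine hmain.trans ?_
  -- per-pair bounds
  set K₁ : ℝ := ω₀ * C₃ * C₄ * (2 * N) * (2 * M + Y) * (2 : ℝ) ^ B₃ * lg ^ B₃ * Real.log (2 * M + Y) ^ B₄ / z
    with hK₁
  set K₃ : ℝ := C₃ * C₄ * (2 * N) * (2 * M + Y) * lg ^ B₃ * Real.log (2 * M + Y) ^ B₄ / Q₀ with hK₃
  set K₂ : ℝ := T * (2 * N / (P₀ * R) + 1) * (ω₀ + 1) with hK₂
  have hlg' : 0 ≤ Real.log (2 * M + Y) := Real.log_nonneg hMY
  have hK₁0 : 0 ≤ K₁ := by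
    have : 0 ≤ lg ^ B₃ := Real.rpow_nonneg hlg0 _
    have : 0 ≤ Real.log (2 * M + Y) ^ B₄ := Real.rpow_nonneg hlg' _
    have : 0 ≤ (2 : ℝ) ^ B₃ := Real.rpow_nonneg (by norm_num) _
    positivity
  have hK₃0 : 0 ≤ K₃ := by
    have : 0 ≤ lg ^ B₃ := Real.rpow_nonneg hlg0 _
    have : 0 ≤ Real.log (2 * M + Y) ^ B₄ := Real.rpow_nonneg hlg' _
    positivity
  have hK₂0 : 0 ≤ K₂ := by positivity
  set a' := b + ⌈B₄⌉₊ with ha'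
  set c' := ⌈B₃⌉₊ + ⌈B₄⌉₊ with hc'
  set d' := b + 1 + ⌈B₃⌉₊ + ⌈B₄⌉₊ with hd'
  have hpair : ∀ r ∈ dyadic R, ∀ q₁ ∈ dyadic Q,
      |γ q₁| * l2Sq N β *
        (ω₀ * (C₃ * (2 * N / r) * (2 * (σ 0 r : ℝ) * lg) ^ B₃ / z *
            (C₄ * ((2 * M + Y) / ((q₁ * r : ℕ) : ℝ)) * ((σ 0 (q₁ * r) : ℝ) * Real.log (2 * M + Y)) ^ B₄) +
            T * (2 * N / (P₀ * R) + 1) * ((2 * M + Y) / ((q₁ * r : ℕ) : ℝ) + 1)) +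
          (σ 0 q₁ : ℝ) * (C₃ * (2 * N / (Q₀ * r)) * ((σ 0 q₁ : ℝ) * (σ 0 r : ℝ) * lg) ^ B₃ *
            (C₄ * ((2 * M + Y) / ((q₁ * r : ℕ) : ℝ)) * ((σ 0 (q₁ * r) : ℝ) * Real.log (2 * M + Y)) ^ B₄) +
            T * (2 * N / (P₀ * R) + 1) * ((2 * M + Y) / ((q₁ * r : ℕ) : ℝ) + 1))) ≤
      l2Sq N β * (K₁ * ((σ 0 q₁ : ℝ) ^ a' / q₁ * ((σ 0 r : ℝ) ^ c' / (r : ℝ) ^ 2)) +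
        K₃ * ((σ 0 q₁ : ℝ) ^ d' / q₁ * ((σ 0 r : ℝ) ^ c' / (r : ℝ) ^ 2)) +
        K₂ * ((σ 0 q₁ : ℝ) ^ (b + 1) * ((2 * M + Y) / ((q₁ : ℝ) * r) + 1))) := by
    intro r hr q₁ hq₁
    have h := e1_pair_le hMY (by linarith) hQ₀ hz hC₃ hC₄ hB₄ hT hω₀ hlg0 hP₀ hR0 hγ
      (pos_of_mem_dyadic hR0.le hr) (pos_of_mem_dyadic hQ0.le hq₁)
      (M := M) (Y := Y) (N := N) (B₃ := B₃) (lg := lg)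
    rw [mul_comm (|γ q₁|) (l2Sq N β), mul_assoc]
    exact mul_le_mul_of_nonneg_left h hl2
  calc _ ≤ ∑ r ∈ dyadic R, ∑ q₁ ∈ dyadic Q,
        l2Sq N β * (K₁ * ((σ 0 q₁ : ℝ) ^ a' / q₁ * ((σ 0 r : ℝ) ^ c' / (r : ℝ) ^ 2)) +
          K₃ * ((σ 0 q₁ : ℝ) ^ d' / q₁ * ((σ 0 r : ℝ) ^ c' / (r : ℝ) ^ 2)) +
          K₂ * ((σ 0 q₁ : ℝ) ^ (b + 1) * ((2 * M + Y) / ((q₁ : ℝ) * r) + 1))) :=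
        Finset.sum_le_sum fun r hr => Finset.sum_le_sum fun q₁ hq₁ => hpair r hr q₁ hq₁
    _ = l2Sq N β * (K₁ * ((∑ q ∈ dyadic Q, (σ 0 q : ℝ) ^ a' / q) * ∑ r ∈ dyadic R, (σ 0 r : ℝ) ^ c' / (r : ℝ) ^ 2) +
          K₃ * ((∑ q ∈ dyadic Q, (σ 0 q : ℝ) ^ d' / q) * ∑ r ∈ dyadic R, (σ 0 r : ℝ) ^ c' / (r : ℝ) ^ 2) +
          K₂ * ((2 * M + Y) * (∑ q ∈ dyadic Q, (σ 0 q : ℝ) ^ (b + 1) / q) * (∑ r ∈ dyadic R, (1 / (r : ℝ))) +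
            (∑ q ∈ dyadic Q, (σ 0 q : ℝ) ^ (b + 1)) * (dyadic R).card)) := by
        -- expand both sides into the same triple of double sums
        have e : ∀ r q₁, l2Sq N β * (K₁ * ((σ 0 q₁ : ℝ) ^ a' / q₁ * ((σ 0 r : ℝ) ^ c' / (r : ℝ) ^ 2)) +
            K₃ * ((σ 0 q₁ : ℝ) ^ d' / q₁ * ((σ 0 r : ℝ) ^ c' / (r : ℝ) ^ 2)) +
            K₂ * ((σ 0 q₁ : ℝ) ^ (b + 1) * ((2 * M + Y) / ((q₁ : ℝ) * r) + 1))) =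
            l2Sq N β * K₁ * (((σ 0 q₁ : ℝ) ^ a' / q₁) * ((σ 0 r : ℝ) ^ c' / (r : ℝ) ^ 2)) +
            l2Sq N β * K₃ * (((σ 0 q₁ : ℝ) ^ d' / q₁) * ((σ 0 r : ℝ) ^ c' / (r : ℝ) ^ 2)) +
            l2Sq N β * K₂ * (2 * M + Y) * (((σ 0 q₁ : ℝ) ^ (b + 1) / q₁) * (1 / (r : ℝ))) +
            l2Sq N β * K₂ * ((σ 0 q₁ : ℝ) ^ (b + 1) * 1) := by
          intro r q₁
          ring
        simp_rw [e]
        simp only [Finset.sum_add_distrib, ← Finset.mul_sum, ← Finset.sum_mul]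
        simp only [Finset.sum_const, nsmul_eq_mul, mul_one]
        ring
    _ ≤ _ := by
        have hA := ha.sum_dyadic_div_le hQ
        have hC := hc.sum_dyadic_div_sq_le hR
        have hD := hd.sum_dyadic_div_le hQ
        have hE := he.sum_dyadic_div_le hQ
        have hE' := he.sum_dyadic_le hQ
        have hinv := sum_dyadic_inv_le hR
        have hcard := card_dyadic_le hR0.le
        have hA0 : 0 ≤ ∑ q ∈ dyadic Q, (σ 0 q : ℝ) ^ a' / q := Finset.sum_nonneg fun _ _ => by positivity
        have hC0 : 0 ≤ ∑ r ∈ dyadic R, (σ 0 r : ℝ) ^ c' / (r : ℝ) ^ 2 := Finset.sum_nonneg fun _ _ => by positivity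
        have hD0 : 0 ≤ ∑ q ∈ dyadic Q, (σ 0 q : ℝ) ^ d' / q := Finset.sum_nonneg fun _ _ => by positivity
        have hE0 : 0 ≤ ∑ q ∈ dyadic Q, (σ 0 q : ℝ) ^ (b + 1) / q := Finset.sum_nonneg fun _ _ => by positivity
        have hE'0 : 0 ≤ ∑ q ∈ dyadic Q, (σ 0 q : ℝ) ^ (b + 1) := Finset.sum_nonneg fun _ _ => by positivity
        have hinv0 : 0 ≤ ∑ r ∈ dyadic R, (1 / (r : ℝ)) := Finset.sum_nonneg fun _ _ => by positivity
        have hlogR : 0 ≤ Real.log (4 * R) := Real.log_nonneg (by linarith)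
        have hlogQ : 0 ≤ Real.log (4 * Q) := Real.log_nonneg (by linarith)
        have hCc' : 0 ≤ 4 * Cc * Real.log (4 * R) ^ kc / R := by positivity
        refine mul_le_mul_of_nonneg_left ?_ hl2
        refine add_le_add (add_le_add ?_ ?_) ?_
        · exact mul_le_mul_of_nonneg_left (mul_le_mul hA hC hC0 (hA0.trans hA)) hK₁0
        · exact mul_le_mul_of_nonneg_left (mul_le_mul hD hC hC0 (hD0.trans hD)) hK₃0
        · refine mul_le_mul_of_nonneg_left (add_le_add ?_ ?_) hK₂0
          · exact mul_le_mul (mul_le_mul_of_nonneg_left hE (by linarith)) hinv hinv0 (by positivity)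
          · exact mul_le_mul hE' hcard (Nat.cast_nonneg _) (hE'0.trans hE')

end BFI

end Literature.NumberTheory.Sieve
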